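import Literature.Computability.AlgebraicComplexity.ProductPlusPowerObstructions
import Literature.Computability.AlgebraicComplexity.DeterminantIrreducible
import Literature.Computability.AlgebraicComplexity.LinSubst
import Literature.Computability.AlgebraicComplexity.OrbitClosureWeights
import Literature.NumberTheory.DiophantineGeometry.SchurWeylPlethysmKroneckerBoundProofs
import Mathlib.RingTheory.MvPolynomial.WeightedHomogeneous
import Mathlib.RingTheory.RootsOfUnity.Complex
import HarnessLib

/-!
# Dutta–Gesmundo–Ikenmeyer–Jindal–Lysikov, Thm. 4.10: the two upper bounds `≤ 4` (Prop. 4.11) and `≤ 5`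

Topic `Literature/Computability/AlgebraicComplexity`, companion of `ProductPlusPowerObstructions.lean`
(the named fact `DGIJL2025_thm_4_10`, Dutta–Gesmundo–Ikenmeyer–Jindal–Lysikov, *Geometric complexity
theory for product-plus-power*, J. Symbolic Comput. (2025) 102458 = arXiv:2211.07055, Thm. 4.10:
"`mult_λ(ℂ[\overline{GL_{d+1} P^{[d]}_{1,1}}]) ≤ 4 < 5 = mult_λ(ℂ[\overline{GL_{d+1} (x₁^d + ⋯ + x_{d+1}^d)}])`"
for even `d ≥ 3` and `λ = (5d-1,1) + ((d+1) × (10d)) = (15d-1, 10d+1, 10d, …, 10d)`). This file PROVES,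
for every `d ≥ 3` (indeed the arguments run for `d ≥ 2`), two of the three inequalities behind that fact
(`≤ 4`, and `= 5` read as `≤ 5 ∧ ≥ 5`):

* Prop. 4.11 (the upper bound of Thm. 4.10):
  "`mult_λ(ℂ[\overline{GL_{d+1} P^{[d]}_{1,1}}]) ≤ mult_λ(ℂ[GL_{d+1} P^{[d]}_{1,1}]) = mult_ν(ℂ[GL_{d+1} P^{[d]}_{1,1}]) = 4`",
  `P^{[d]}_{1,1} = x₁⋯x_d + x₀^d` (`productPlusPower`), `ν = (5d-1, 1)` — here the inequality
  `mult_λ(ℂ[\overline{GL_{d+1} P^{[d]}_{1,1}}]) ≤ 4` in the tree's rendering, `orbitMultiplicity` at the dual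
  weight `Weight.dualOfPartition (d+1) λ` exactly as in `DGIJL2025_thm_4_10`
  (`orbitMultiplicity_productPlusPower_le_four`; general-weight form
  `DGIJL2025.orbitMultiplicity_productPlusPower_le_four'`).

* the upper half `mult_λ(ℂ[\overline{GL_{d+1}(x₀^d + ⋯ + x_d^d)}]) ≤ 5` of Thm. 4.10's
  "`5 = mult_λ(ℂ[\overline{GL_{d+1} (x_1^d + ⋯ + x_{d+1}^d)}])`" (`orbitMultiplicity_psum_dgijl_le_five`;
  general-weight form `DGIJL2025.orbitMultiplicity_psum_le_five'`): in print this is the localisation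
  inequality with the orbit count `mult_ν ℂ[GL_{d+1} p] = Σ_{κ ⊢ 5} b(ν,κ,d,5) = 5` of [IK'20, Prop. 4.1]
  carried out in the proof of Prop. 4.12 ("κ has exactly two nonzero entries in 5 cases").

The named fact itself is NOT discharged here: what remains is Thm. 4.10's lower bound Prop. 4.12,
"`mult_λ(…x_1^d+⋯+x_{d+1}^d…) ≥ 5`" (tableau lifting, [IK'20, Main Technical Thm. 4.2] with
`e_Ξ = 10`), the only place where the parity hypothesis "`d` even" is used;
`DGIJL2025_thm_4_10_of_five_le` records the reduction of `DGIJL2025_thm_4_10` to that bound.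

## Proof route — the semi-invariant classification of `PowerSumProductMultiplicityObstruction.lean`
(IK'20 Thm. 4.3, second bullet), NOT the printed plethysm count

The printed proof bounds the closure multiplicity by the orbit multiplicity (`ℂ[GL P]` is a localisation
of `ℂ[\overline{GL P}]`, [BI17]) and computes the latter as a sum of plethysm coefficients over the
stabilizer, `a_{(d)}(d,1) + a_{(2d)}(d,2) + a_{(3d)}(d,3) + a_{(4d)}(d,4) = 4` (hooks contribute `0`). Here,
as in the tree's proof of IK'20 Thm. 4.3: the injection `HW_χ(ℂ[\overline{GL·f}]) ↪ ℂ[Mat_{d+1}]`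
(`hwToPoly`, BLMW 2011 §5.2) lands in polynomials `P` with `P(bg) = χ(b)⁻¹ P(g)` (`b` upper triangular)
and `P(gh) = P(g)` for `h` in the stabilizer of `f = x₁⋯x_d + x₀^d`, which contains the torus elements
`diag(1, …, 2, …, 2⁻¹, …)` (positions `≥ 1`) and the permutation matrices fixing the coordinate `0`
(`IsPPoly`, §2). Row degrees are `ρ = (10d, …, 10d, 10d+1, 15d-1)` and the column degrees in the columns
`≥ 1` agree monomial by monomial; the row-`0` elimination trick of IK'20 gives `det^{10d} ∣ P` (§3). The
quotient `P₁ = P / det^{10d}` (§4) has row degrees `(0, …, 0, 1, 5d-1)`, balanced columns `≥ 1`, is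
invariant under the column permutations fixing `0` (as `det(gτ) = ± det(g)` and `10d` is even — the
paper's "even number of columns") and under the raising substitution `z_{d-1} ↦ z_{d-1} + z_d` (the
unipotent `1 + E_{d-1,d}`, on which `χ` is trivial); hence (§5) every monomial of `P₁` is
`z_{d-1,j} z_d^{F_c - e_j}` with column content `F_c = (5d - dc, c, …, c)`, `0 ≤ c ≤ 5`, its coefficients
`a_{c,j}` satisfy the raising relations `∑_j a_{c,j} = 0` and the symmetry `a_{c,1} = ⋯ = a_{c,d}`, which
kill `c = 0`, `c = 5` and leave one free coefficient `a_{c,1}` for each `c = 1, …, 4` (the paper's four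
summands `a_{(cd)}(d,c) = 1`; the hook summands are the antisymmetric combinations killed by the
symmetry): `P₁ ↦ (a_{c,1})_{c=1..4}` is injective (§6, `eq_zero_of_coeff_eq_zero`), so the highest-weight
space has dimension `≤ 4` (§6–§7). §8 identifies `Weight.dualOfPartition (d+1) λ` with `-ρ`.

Power-sum side (§9–§10, §7b): the stabilizer of `x₀^d + ⋯ + x_d^d` contains the `d`-th roots of unity
on every coordinate and all of `S_{d+1}` (`IsSPoly`); the shared Borel part (`IsLPoly`) gives the same
row degrees and the factor `det^{10d}` (§3); the roots of unity force every column degree to be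
`≡ 0 (mod d)`, a condition transported to `P₁` through a `ZMod d`-valued column weight (§9); so the
monomials of `P₁` are `z_{d-1,j} z_d^{d·m - e_j}` with `∑ m = 5`, `m_j ≥ 1`, their coefficients
`a(m, j)` are constant on `S_{d+1}`-orbits and satisfy the raising relations `∑_{j : m_j ≠ 0} a(m,j) = 0`
(§10). A content vector `m` with `∑ m = 5` has at most two distinct nonzero values (`1+2+3 > 5`); a
one-valued orbit is killed by its relation, a two-valued one (`v` on `a` columns, `w` on `b` columns,
`va + wb = 5`) is carried by a column permutation (`Equiv.ofFiberEquiv` on the value fibers) to the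
block representative `mRep v a w b` and is pinned by the single coefficient `a(mRep, 0)`; the solutions
of `va + wb = 5`, `v > w ≥ 1` are the five two-valued partitions of `5`, so `P₁ ↦ (a(mRep_κ, 0))_κ` is
injective (`eq_zero_of_forall_aS_mRep`) and the highest-weight space has dimension `≤ 5`
(`finrank_le_five_of_forall_isSPoly`).

## References

* P. Dutta, F. Gesmundo, C. Ikenmeyer, G. Jindal, V. Lysikov, *Geometric complexity theory for
  product-plus-power*, J. Symbolic Comput. (2025) 102458; arXiv:2211.07055, Thm. 4.10, Prop. 4.11,
  Prop. 4.12. [DuttaGesmundoIkenmeyerJindalLysikovJSC2025]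
* C. Ikenmeyer, U. Kandasamy, *Implementing geometric complexity theory: on the separation of orbit
  closures via symmetries*, STOC 2020, arXiv:1911.03990, Prop. 4.1, Thm. 4.2, Thm. 4.3. [IkenmeyerKandasamy2019]
* P. Bürgisser, J. M. Landsberg, L. Manivel, J. Weyman, *An overview of mathematical issues arising in
  the geometric complexity theory approach to VP ≠ VNP*, SIAM J. Comput. 40 (2011), §5.2. [BLMW2011]

Provenance: pub-gct-max cell, track T (lit-1), Stages 1a–1b of the DGIJL Thm. 4.10 blueprint;
sections §1–§3 port the corresponding lemmas of `PowerSumProductMultiplicityObstruction.lean`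
(IK'20 Thm. 4.3) to the row degrees `ρ`.
-/

noncomputable section

open scoped BigOperators

namespace Literature.Computability.AlgebraicComplexity

namespace DGIJL2025

open MvPolynomial
open _root_.Literature.NumberTheory.DiophantineGeometry

/-! ### §1 Rescaling variables, row and column degrees, quotients (ported from `IK2020`) -/

section Rescale

variable {σ τ : Type*} {A : Type*} [CommSemiring A]

/-- Coefficients after rescaling the variables `X_v ↦ t_v X_v`. [folklore] -/
private theorem coeff_aeval_scale (t : σ → A) (φ : MvPolynomial σ A) (d : σ →₀ ℕ) :
    coeff d (aeval (fun v => C (t v) * X v) φ) = (d.prod fun v n => t v ^ n) * coeff d φ := by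
  classical
  induction φ using MvPolynomial.induction_on' with
  | monomial e c =>
    have hprod : (e.prod fun v n => (C (t v) * X v : MvPolynomial σ A) ^ n) =
        C (e.prod fun v n => t v ^ n) * e.prod fun v n => (X v : MvPolynomial σ A) ^ n := by
      rw [map_finsuppProd, ← Finsupp.prod_mul]
      exact Finsupp.prod_congr fun v _ => by rw [mul_pow, C_pow]
    rw [aeval_monomial, hprod, algebraMap_eq, ← mul_assoc, ← C_mul, ← monomial_eq, coeff_monomial,
      coeff_monomial]
    split_ifs with h
    · subst h; ring
    · rw [mul_zero]
  | add p q hp hq => rw [map_add, coeff_add, coeff_add, hp, hq, mul_add]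

/-- Evaluating a substituted polynomial: `(φ ∘ F)(x) = φ(F(x))`. [folklore] -/
private theorem eval_aeval_eq (x : τ → A) (F : σ → MvPolynomial τ A) (φ : MvPolynomial σ A) :
    eval x (aeval F φ) = eval (fun i => eval x (F i)) φ := by
  rw [aeval_eq_bind₁]
  exact eval₂Hom_bind₁ _ _ _ _

end Rescale



section Weights

variable (N : ℕ)

/-- The bi-degree weight: the variable `z_{ij}` has weight `(e_i, e_j)` (row content, column
content). [folklore] -/
def wRC : Fin N × Fin N → (Fin N → ℕ) × (Fin N → ℕ) :=
  fun v => (fun i => if v.1 = i then 1 else 0, fun j => if v.2 = j then 1 else 0)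

variable {N}

/-- Row degrees of a monomial. [folklore] -/
private theorem weight_wRC_fst (e : Fin N × Fin N →₀ ℕ) (i : Fin N) :
    (Finsupp.weight (wRC N) e).1 i = ∑ v ∈ e.support, if v.1 = i then e v else 0 := by
  rw [Finsupp.weight_apply, Finsupp.sum, Prod.fst_sum, Finset.sum_apply]
  refine Finset.sum_congr rfl fun v _ => ?_
  simp [wRC]

/-- Column degrees of a monomial. [folklore] -/
private theorem weight_wRC_snd (e : Fin N × Fin N →₀ ℕ) (j : Fin N) :
    (Finsupp.weight (wRC N) e).2 j = ∑ v ∈ e.support, if v.2 = j then e v else 0 := by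
  rw [Finsupp.weight_apply, Finsupp.sum, Prod.snd_sum, Finset.sum_apply]
  refine Finset.sum_congr rfl fun v _ => ?_
  simp [wRC]

/-- The total degree is the sum of the row degrees. [folklore] -/
private theorem sum_weight_wRC_fst (e : Fin N × Fin N →₀ ℕ) :
    ∑ i, (Finsupp.weight (wRC N) e).1 i = ∑ v ∈ e.support, e v := by
  simp_rw [weight_wRC_fst]
  rw [Finset.sum_comm]
  exact Finset.sum_congr rfl fun v _ => by rw [Finset.sum_ite_eq, if_pos (Finset.mem_univ _)]

/-- The total degree is the sum of the column degrees. [folklore] -/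
private theorem sum_weight_wRC_snd (e : Fin N × Fin N →₀ ℕ) :
    ∑ j, (Finsupp.weight (wRC N) e).2 j = ∑ v ∈ e.support, e v := by
  simp_rw [weight_wRC_snd]
  rw [Finset.sum_comm]
  exact Finset.sum_congr rfl fun v _ => by rw [Finset.sum_ite_eq, if_pos (Finset.mem_univ _)]

variable {A : Type*} [CommSemiring A]

/-- The rescaling factor of a monomial under `z_{i₀ j} ↦ a z_{i₀ j}` is `a^{row degree}`.
[folklore] -/
private theorem prod_pow_ite_fst (e : Fin N × Fin N →₀ ℕ) (i₀ : Fin N) (a : A) :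
    (e.prod fun v n => (if v.1 = i₀ then a else 1) ^ n) = a ^ (Finsupp.weight (wRC N) e).1 i₀ := by
  rw [weight_wRC_fst, Finsupp.prod, ← Finset.prod_pow_eq_pow_sum]
  refine Finset.prod_congr rfl fun v _ => ?_
  split_ifs <;> simp

/-- The rescaling factor of a monomial under `z_{i j₀} ↦ a z_{i j₀}` is `a^{column degree}`.
[folklore] -/
private theorem prod_pow_ite_snd (e : Fin N × Fin N →₀ ℕ) (j₀ : Fin N) (a : A) :
    (e.prod fun v n => (if v.2 = j₀ then a else 1) ^ n) = a ^ (Finsupp.weight (wRC N) e).2 j₀ := by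
  rw [weight_wRC_snd, Finsupp.prod, ← Finset.prod_pow_eq_pow_sum]
  refine Finset.prod_congr rfl fun v _ => ?_
  split_ifs <;> simp

/-- **Row scaling identity**: if every monomial of `φ` has degree `r` in the row `i₀`, then
substituting `W · f` for the row-`i₀` variables multiplies the value by `W^r`. [folklore] -/
private theorem aeval_rowScale {B : Type*} [CommSemiring B] [Algebra A B] (φ : MvPolynomial (Fin N × Fin N) A)
    (i₀ : Fin N) (r : ℕ) (hφ : ∀ e ∈ φ.support, (Finsupp.weight (wRC N) e).1 i₀ = r)
    (f : Fin N × Fin N → B) (W : B) :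
    aeval (fun v => if v.1 = i₀ then W * f v else f v) φ = W ^ r * aeval f φ := by
  rw [φ.as_sum, map_sum, map_sum, Finset.mul_sum]
  refine Finset.sum_congr rfl fun e he => ?_
  rw [aeval_monomial, aeval_monomial, ← hφ e he, ← prod_pow_ite_fst e i₀ W]
  have : (e.prod fun v n => (if v.1 = i₀ then W * f v else f v) ^ n) =
      (e.prod fun v n => (if v.1 = i₀ then W else 1) ^ n) * e.prod fun v n => f v ^ n := by
    rw [← Finsupp.prod_mul]
    exact Finsupp.prod_congr fun v _ => by split_ifs <;> simp [mul_pow]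
  rw [this]; ring

end Weights



section Quotient

variable {σ M A : Type*} [AddCancelCommMonoid M] [DecidableEq M] [CommRing A] [NoZeroDivisors A]

/-- **A quotient of weighted homogeneous polynomials is weighted homogeneous** (integral
coefficients): if `p ≠ 0` is homogeneous of weight `a`, `p q` is homogeneous of weight `c` and
`a + n = c`, then `q` is homogeneous of weight `n`. [folklore] -/
private theorem isWeightedHomogeneous_of_mul {w : σ → M} {p q : MvPolynomial σ A} {a c n : M}
    (hp : IsWeightedHomogeneous w p a) (hp0 : p ≠ 0) (hpq : IsWeightedHomogeneous w (p * q) c)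
    (hn : a + n = c) : IsWeightedHomogeneous w q n := by
  classical
  intro d hd
  by_contra hne
  set qn := weightedHomogeneousComponent w (Finsupp.weight w d) q with hqn
  have hqn0 : qn ≠ 0 := by
    intro h
    apply hd
    have := congrArg (coeff d) h
    rwa [hqn, coeff_weightedHomogeneousComponent, if_pos rfl, coeff_zero] at this
  have h1 : weightedHomogeneousComponent w (a + Finsupp.weight w d) (p * q) = 0 :=
    hpq.weightedHomogeneousComponent_ne _ fun h => hne (add_left_cancel (h.trans hn.symm))
  have h2 : weightedHomogeneousComponent w (a + Finsupp.weight w d) (p * q) = p * qn := by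
    have hsplit : p * q = p * qn + p * (q - qn) := by ring
    rw [hsplit, map_add,
      (hp.mul (weightedHomogeneousComponent_isWeightedHomogeneous _ _)).weightedHomogeneousComponent_same,
      add_eq_left]
    ext d'
    rw [coeff_weightedHomogeneousComponent, coeff_zero]
    split_ifs with hd'
    · rw [coeff_mul]
      refine Finset.sum_eq_zero fun xy hxy => ?_
      by_cases hx : coeff xy.1 p = 0
      · rw [hx, zero_mul]
      by_cases hy : coeff xy.2 (q - qn) = 0
      · rw [hy, mul_zero]
      exfalso
      have hwy : Finsupp.weight w xy.2 ≠ Finsupp.weight w d := by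
        intro h; apply hy
        rw [coeff_sub, hqn, coeff_weightedHomogeneousComponent, if_pos h, sub_self]
      have hwx : Finsupp.weight w xy.1 = a := hp hx
      have hsum := Finset.mem_antidiagonal.mp hxy
      rw [← hsum, map_add, hwx] at hd'
      exact hwy (add_left_cancel hd')
    · rfl
  rw [h2] at h1
  exact hqn0 ((mul_eq_zero.mp h1).resolve_left hp0)

end Quotient

/-! ### §2 The generic matrix, the weight, and the hypotheses on a semi-invariant -/

section Structure

variable (n : ℕ)

/-- The polynomial ring of the matrix space `Mat_N`, `N = n + 2 + 1 = d + 1`. [folklore] -/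
abbrev Rm : Type := MvPolynomial (Fin (n + 2 + 1) × Fin (n + 2 + 1)) ℂ

/-- The generic matrix `Z = (z_{ij})`. [folklore] -/
abbrev ZZ : Matrix (Fin (n + 2 + 1)) (Fin (n + 2 + 1)) (Rm n) :=
  Matrix.mvPolynomialX (Fin (n + 2 + 1)) (Fin (n + 2 + 1)) ℂ

/-- The minor `δ = det Z[1…, 1…]` (row and column `0` deleted). [folklore] -/
def dMinor : Rm n := ((ZZ n).submatrix Fin.succ Fin.succ).det

/-- The entries of `M₀ = [e_0; z_1; …; z_{N-1}]`: the generic matrix with row `0` replaced by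
`e_0`. [folklore] -/
def M0 (v : Fin (n + 2 + 1) × Fin (n + 2 + 1)) : Rm n :=
  if v.1 = 0 then (if v.2 = 0 then 1 else 0) else X v

/-- The row degrees `ρ = (10d, …, 10d, 10d+1, 15d-1)` (`d = n + 2`) of a semi-invariant of weight
`λ^*`, `λ = (15d-1, 10d+1, 10d, …, 10d)`. [cite: DuttaGesmundoIkenmeyerJindalLysikovJSC2025, Thm. 4.10] -/
def rho (i : Fin (n + 2 + 1)) : ℕ :=
  if (i : ℕ) = n + 2 then 15 * (n + 2) - 1 else if (i : ℕ) = n + 1 then 10 * (n + 2) + 1 else 10 * (n + 2)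

/-- The exponent `r = 10d` of the determinant factor. [folklore] -/
def rr : ℕ := 10 * (n + 2)

/-- `r = 10 d`. [folklore] -/
private theorem rr_def : rr n = 10 * (n + 2) := rfl

/-- The test torus element `diag(…, 2, …, 2⁻¹, …)` (`2` at `a`, `2⁻¹` at `b`). [folklore] -/
def tAB (a b : Fin (n + 2 + 1)) (j : Fin (n + 2 + 1)) : ℂ := if j = a then 2 else if j = b then 2⁻¹ else 1

/-- The test torus element has nonzero entries. [folklore] -/
private theorem tAB_ne_zero (a b j : Fin (n + 2 + 1)) : tAB n a b j ≠ 0 := by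
  unfold tAB; split_ifs <;> norm_num

/-- The row index `d - 1 = n + 1`. [folklore] -/
def iA : Fin (n + 2 + 1) := ⟨n + 1, by omega⟩

/-- The row index `d = n + 2` (the last row). [folklore] -/
def iB : Fin (n + 2 + 1) := ⟨n + 2, by omega⟩

/-- The row degrees `ρ' = (0, …, 0, 1, 5d-1)` of the quotient `P₁ = P / det^{10d}`. [folklore] -/
def rho1 (i : Fin (n + 2 + 1)) : ℕ :=
  if (i : ℕ) = n + 2 then 5 * (n + 2) - 1 else if (i : ℕ) = n + 1 then 1 else 0

/-- The raising substitution `z_{d-1,j} ↦ z_{d-1,j} + z_{d,j}` (left multiplication by the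
transvection `1 + E_{d-1,d}`). [folklore] -/
def theta (v : Fin (n + 2 + 1) × Fin (n + 2 + 1)) : Rm n :=
  if v.1 = iA n then X v + X (iB n, v.2) else X v

/-- The index map moving the row `d - 1` onto the row `d`. [folklore] -/
def piIdx (v : Fin (n + 2 + 1) × Fin (n + 2 + 1)) : Fin (n + 2 + 1) × Fin (n + 2 + 1) :=
  if v.1 = iA n then (iB n, v.2) else v

/-- The exponent supported on the row `i` with column contents `f`. [folklore] -/
def rowExp (i : Fin (n + 2 + 1)) (f : Fin (n + 2 + 1) →₀ ℕ) : Fin (n + 2 + 1) × Fin (n + 2 + 1) →₀ ℕ :=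
  f.mapDomain (Prod.mk i)

/-- The exponent of the monomial `z_{d-1,j} · z_d^f`. [folklore] -/
def eps (j : Fin (n + 2 + 1)) (f : Fin (n + 2 + 1) →₀ ℕ) : Fin (n + 2 + 1) × Fin (n + 2 + 1) →₀ ℕ :=
  Finsupp.single (iA n, j) 1 + rowExp n (iB n) f

/-- The column contents `F_c = (5d - dc, c, …, c)`. [folklore] -/
def Fc (c : ℕ) : Fin (n + 2 + 1) →₀ ℕ :=
  Finsupp.equivFunOnFinite.symm fun j => if j = 0 then 5 * (n + 2) - (n + 2) * c else c

/-- The transvection `1 + E_{d-1,d}` as an element of `GL`. [folklore] -/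
def Tg : GL (Fin (n + 2 + 1)) ℂ :=
  Matrix.GeneralLinearGroup.mkOfDetNeZero (Matrix.transvection (iA n) (iB n) (1 : ℂ)) (by
    rw [Matrix.det_transvection_of_ne]
    · exact one_ne_zero
    · simp [iA, iB, Fin.ext_iff])

/-- A primitive `d`-th root of unity, `d = n + 2`. [folklore] -/
def zeta : ℂ := Complex.exp (2 * Real.pi * Complex.I / ((n + 2 : ℕ) : ℂ))

/-- The stabilizing torus element `diag(1, …, ζ, …, 1)` (`ζ` at `j`) of the power sum. [folklore] -/
def rootVec (j : Fin (n + 2 + 1)) (i : Fin (n + 2 + 1)) : ℂ := if i = j then zeta n else 1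

/-- The stabilizing torus element has nonzero entries. [folklore] -/
private theorem rootVec_ne_zero (j i : Fin (n + 2 + 1)) : rootVec n j i ≠ 0 := by
  unfold rootVec
  split_ifs
  · exact Complex.exp_ne_zero _
  · exact one_ne_zero

/-- The column-`j` degree modulo `d` as a weight with values in `ZMod d`. [folklore] -/
def wColZ (j : Fin (n + 2 + 1)) (v : Fin (n + 2 + 1) × Fin (n + 2 + 1)) : ZMod (n + 2) :=
  if v.2 = j then 1 else 0

/-- The block representative of a two-valued column content: `v` on the first `a` columns, `w` on
the next `b`, `0` elsewhere. [folklore] -/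
def mRep (v a w b : ℕ) : Fin (n + 2 + 1) →₀ ℕ :=
  Finsupp.equivFunOnFinite.symm fun j => if (j : ℕ) < a then v else if (j : ℕ) < a + b then w else 0

variable {n}

/-- A permutation matrix as an element of `GL`. [folklore] -/
private def permGL (τ : Equiv.Perm (Fin (n + 2 + 1))) : GL (Fin (n + 2 + 1)) ℂ :=
  Matrix.GeneralLinearGroup.mkOfDetNeZero (τ.permMatrix ℂ) (by
    rw [Matrix.det_permutation]
    rcases Int.units_eq_one_or (Equiv.Perm.sign τ) with h | h <;> simp [h])

/-- The matrix of `permGL τ`. [folklore] -/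
private theorem coe_permGL (τ : Equiv.Perm (Fin (n + 2 + 1))) :
    ((permGL τ : GL (Fin (n + 2 + 1)) ℂ) : Matrix (Fin (n + 2 + 1)) (Fin (n + 2 + 1)) ℂ) = τ.permMatrix ℂ :=
  Matrix.GeneralLinearGroup.val_mkOfDetNeZero _ _

/-- The matrix of `Tg`. [folklore] -/
private theorem coe_Tg :
    ((Tg n : GL (Fin (n + 2 + 1)) ℂ) : Matrix (Fin (n + 2 + 1)) (Fin (n + 2 + 1)) ℂ) =
      Matrix.transvection (iA n) (iB n) (1 : ℂ) :=
  Matrix.GeneralLinearGroup.val_mkOfDetNeZero _ _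

/-- `iA ≠ iB`. [folklore] -/
private theorem iA_ne_iB : iA n ≠ iB n := by simp [iA, iB, Fin.ext_iff]

/-- `1 ≠ 0` in `Fin (n + 2 + 1)`. [folklore] -/
private theorem one_ne_zero₃ : (1 : Fin (n + 2 + 1)) ≠ 0 := by simp

/-- `ρ'_{d-1} = 1`. [folklore] -/
private theorem rho1_iA : rho1 n (iA n) = 1 := by simp [rho1, iA]

/-- `ρ'_d = 5d - 1`. [folklore] -/
private theorem rho1_iB : rho1 n (iB n) = 5 * (n + 2) - 1 := by simp [rho1, iB]

/-- `ρ'_i = 0` off the last two rows. [folklore] -/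
private theorem rho1_of_ne {i : Fin (n + 2 + 1)} (hA : i ≠ iA n) (hB : i ≠ iB n) : rho1 n i = 0 := by
  unfold rho1
  have hA' : (i : ℕ) ≠ n + 1 := fun h => hA (Fin.ext (by simp [iA, h]))
  have hB' : (i : ℕ) ≠ n + 2 := fun h => hB (Fin.ext (by simp [iB, h]))
  rw [if_neg hB', if_neg hA']

/-- `ρ = 10d · 𝟙 + ρ'`. [folklore] -/
private theorem rho_eq_add (i : Fin (n + 2 + 1)) : rho n i = rr n + rho1 n i := by
  unfold rho rr rho1
  split_ifs <;> omega

/-- `∑ ρ' = 5d`. [folklore] -/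
private theorem sum_rho1 : ∑ i, rho1 n i = 5 * (n + 2) := by
  rw [Fintype.sum_eq_add (iA n) (iB n) iA_ne_iB fun i hi => rho1_of_ne hi.1 hi.2, rho1_iA, rho1_iB]
  omega

/-- The product of the entries of the test torus element is `1`. [folklore] -/
private theorem prod_tAB {a b : Fin (n + 2 + 1)} (hab : a ≠ b) : ∏ j, tAB n a b j = 1 := by
  rw [prod_eq_mul_of_ne hab (tAB n a b) fun l hla hlb => by unfold tAB; rw [if_neg hla, if_neg hlb]]
  unfold tAB
  rw [if_pos rfl, if_neg (Ne.symm hab), if_pos rfl]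
  norm_num

/-- `ρ_0 = 10d`. [folklore] -/
private theorem rho_zero : rho n 0 = rr n := by
  unfold rho rr
  have h1 : ((0 : Fin (n + 2 + 1)) : ℕ) ≠ n + 2 := by rw [Fin.val_zero]; omega
  have h2 : ((0 : Fin (n + 2 + 1)) : ℕ) ≠ n + 1 := by rw [Fin.val_zero]; omega
  rw [if_neg h1, if_neg h2]

/-- The hypotheses on a polynomial `P` on `Mat_N` coming from a highest-weight vector of weight
`χ = λ^*` in `ℂ[\overline{GL_N · (x₁⋯x_d + x₀^d)}]`: left semi-invariance under the upper triangular
Borel, right invariance under the test torus elements and the permutations of the stabilizer, and the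
values of `χ`. [cite: DuttaGesmundoIkenmeyerJindalLysikovJSC2025, Prop. 4.11] -/
structure IsPPoly (χ : Weight (Fin (n + 2 + 1))) (P : Rm n) : Prop where
  left : ∀ b : GL (Fin (n + 2 + 1)) ℂ, IsUpperTriangular b → ∀ g : GL (Fin (n + 2 + 1)) ℂ,
    eval (fun ij : Fin (n + 2 + 1) × Fin (n + 2 + 1) =>
        ((b : Matrix (Fin (n + 2 + 1)) (Fin (n + 2 + 1)) ℂ) * (g : Matrix (Fin (n + 2 + 1)) (Fin (n + 2 + 1)) ℂ)) ij.1 ij.2) P =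
      (weightChar χ b)⁻¹ *
        eval (fun ij : Fin (n + 2 + 1) × Fin (n + 2 + 1) => (g : Matrix (Fin (n + 2 + 1)) (Fin (n + 2 + 1)) ℂ) ij.1 ij.2) P
  torus : ∀ a b : Fin (n + 2 + 1), a ≠ 0 → b ≠ 0 → a ≠ b → ∀ g : GL (Fin (n + 2 + 1)) ℂ,
    eval (fun ij : Fin (n + 2 + 1) × Fin (n + 2 + 1) =>
        ((g : Matrix (Fin (n + 2 + 1)) (Fin (n + 2 + 1)) ℂ) *
          ((torusElt (tAB n a b) (tAB_ne_zero n a b) : GL (Fin (n + 2 + 1)) ℂ) :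
            Matrix (Fin (n + 2 + 1)) (Fin (n + 2 + 1)) ℂ)) ij.1 ij.2) P =
      eval (fun ij : Fin (n + 2 + 1) × Fin (n + 2 + 1) => (g : Matrix (Fin (n + 2 + 1)) (Fin (n + 2 + 1)) ℂ) ij.1 ij.2) P
  perm : ∀ τ : Equiv.Perm (Fin (n + 2 + 1)), τ 0 = 0 → ∀ g : GL (Fin (n + 2 + 1)) ℂ,
    eval (fun ij : Fin (n + 2 + 1) × Fin (n + 2 + 1) =>
        ((g : Matrix (Fin (n + 2 + 1)) (Fin (n + 2 + 1)) ℂ) * τ.permMatrix ℂ) ij.1 ij.2) P =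
      eval (fun ij : Fin (n + 2 + 1) × Fin (n + 2 + 1) => (g : Matrix (Fin (n + 2 + 1)) (Fin (n + 2 + 1)) ℂ) ij.1 ij.2) P
  chi : ∀ i, χ i = -(rho n i : ℤ)

/-- The part of the hypotheses shared by both sides (product-plus-power and power sum): left
semi-invariance under the Borel and the values of `χ`. [folklore] -/
private structure IsLPoly (χ : Weight (Fin (n + 2 + 1))) (P : Rm n) : Prop where
  left : ∀ b : GL (Fin (n + 2 + 1)) ℂ, IsUpperTriangular b → ∀ g : GL (Fin (n + 2 + 1)) ℂ,
    eval (fun ij : Fin (n + 2 + 1) × Fin (n + 2 + 1) =>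
        ((b : Matrix (Fin (n + 2 + 1)) (Fin (n + 2 + 1)) ℂ) * (g : Matrix (Fin (n + 2 + 1)) (Fin (n + 2 + 1)) ℂ)) ij.1 ij.2) P =
      (weightChar χ b)⁻¹ *
        eval (fun ij : Fin (n + 2 + 1) × Fin (n + 2 + 1) => (g : Matrix (Fin (n + 2 + 1)) (Fin (n + 2 + 1)) ℂ) ij.1 ij.2) P
  chi : ∀ i, χ i = -(rho n i : ℤ)

variable {χ : Weight (Fin (n + 2 + 1))} {P : Rm n}

/-- Forgetting the right invariance. [folklore] -/
private theorem IsPPoly.toL (hP : IsPPoly χ P) : IsLPoly χ P := ⟨hP.left, hP.chi⟩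

/-- The hypotheses on a polynomial `P` on `Mat_N` coming from a highest-weight vector of weight
`χ = λ^*` in `ℂ[\overline{GL_N · (x₀^d + ⋯ + x_d^d)}]`: left semi-invariance under the Borel, right
invariance under the `d`-th roots of unity on every coordinate and under all permutations of the
coordinates, and the values of `χ`. [cite: DuttaGesmundoIkenmeyerJindalLysikovJSC2025, Thm. 4.10] -/
structure IsSPoly (χ : Weight (Fin (n + 2 + 1))) (P : Rm n) : Prop where
  left : ∀ b : GL (Fin (n + 2 + 1)) ℂ, IsUpperTriangular b → ∀ g : GL (Fin (n + 2 + 1)) ℂ,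
    eval (fun ij : Fin (n + 2 + 1) × Fin (n + 2 + 1) =>
        ((b : Matrix (Fin (n + 2 + 1)) (Fin (n + 2 + 1)) ℂ) * (g : Matrix (Fin (n + 2 + 1)) (Fin (n + 2 + 1)) ℂ)) ij.1 ij.2) P =
      (weightChar χ b)⁻¹ *
        eval (fun ij : Fin (n + 2 + 1) × Fin (n + 2 + 1) => (g : Matrix (Fin (n + 2 + 1)) (Fin (n + 2 + 1)) ℂ) ij.1 ij.2) P
  root : ∀ j : Fin (n + 2 + 1), ∀ g : GL (Fin (n + 2 + 1)) ℂ,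
    eval (fun ij : Fin (n + 2 + 1) × Fin (n + 2 + 1) =>
        ((g : Matrix (Fin (n + 2 + 1)) (Fin (n + 2 + 1)) ℂ) *
          ((torusElt (rootVec n j) (rootVec_ne_zero n j) : GL (Fin (n + 2 + 1)) ℂ) :
            Matrix (Fin (n + 2 + 1)) (Fin (n + 2 + 1)) ℂ)) ij.1 ij.2) P =
      eval (fun ij : Fin (n + 2 + 1) × Fin (n + 2 + 1) => (g : Matrix (Fin (n + 2 + 1)) (Fin (n + 2 + 1)) ℂ) ij.1 ij.2) P
  perm : ∀ τ : Equiv.Perm (Fin (n + 2 + 1)), ∀ g : GL (Fin (n + 2 + 1)) ℂ,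
    eval (fun ij : Fin (n + 2 + 1) × Fin (n + 2 + 1) =>
        ((g : Matrix (Fin (n + 2 + 1)) (Fin (n + 2 + 1)) ℂ) * τ.permMatrix ℂ) ij.1 ij.2) P =
      eval (fun ij : Fin (n + 2 + 1) × Fin (n + 2 + 1) => (g : Matrix (Fin (n + 2 + 1)) (Fin (n + 2 + 1)) ℂ) ij.1 ij.2) P
  chi : ∀ i, χ i = -(rho n i : ℤ)

/-- Forgetting the right invariance. [folklore] -/
private theorem IsSPoly.toL (hP : IsSPoly χ P) : IsLPoly χ P := ⟨hP.left, hP.chi⟩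

/-! ### §3 Row degrees, column degrees, and the factor `det^{10d}` (ported from `IK2020`) -/

/-- **Row degrees** of a semi-invariant of weight `λ^*`: `ρ_i` in the row `i` (diagonal part of the
Borel, `GL` dense in `Mat`). [folklore] -/
private theorem rowDeg_eq (hP : IsLPoly χ P) {e : Fin (n + 2 + 1) × Fin (n + 2 + 1) →₀ ℕ} (he : e ∈ P.support)
    (i₀ : Fin (n + 2 + 1)) : (Finsupp.weight (wRC (n + 2 + 1)) e).1 i₀ = rho n i₀ := by
  have hs0 : ∀ i : Fin (n + 2 + 1), (fun i => if i = i₀ then (2 : ℂ) else 1) i ≠ 0 := fun i => by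
    dsimp only; split_ifs <;> norm_num
  have hid : aeval (fun v : Fin (n + 2 + 1) × Fin (n + 2 + 1) =>
      C ((fun i => if i = i₀ then (2 : ℂ) else 1) v.1) * X v) P = C ((2 : ℂ) ^ rho n i₀) * P := by
    apply MvPolynomial.eq_of_eval_eq_on_gl
    intro g
    rw [eval_aeval_eq, map_mul, eval_C]
    have h := hP.left (torusElt _ hs0) (isDiagonalGL_torusElt _ hs0).isUpperTriangular g
    rw [weightChar_torusElt, coe_torusElt] at h
    have hw : (∏ i, (fun i => if i = i₀ then (2 : ℂ) else 1) i ^ χ i)⁻¹ = (2 : ℂ) ^ rho n i₀ := by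
      rw [Finset.prod_eq_single i₀ (fun i _ hi => by simp [hi]) (fun h => absurd (Finset.mem_univ _) h)]
      dsimp only
      rw [if_pos rfl, hP.chi i₀, zpow_neg, inv_inv, zpow_natCast]
    rw [hw] at h
    convert h using 2
    congr 1
    funext v
    rw [map_mul, eval_C, eval_X, Matrix.diagonal_mul]
  have hc := congrArg (coeff e) hid
  rw [coeff_aeval_scale, coeff_C_mul] at hc
  have hprod : (e.prod fun v k => (fun i => if i = i₀ then (2 : ℂ) else 1) v.1 ^ k) =
      (2 : ℂ) ^ (Finsupp.weight (wRC (n + 2 + 1)) e).1 i₀ := prod_pow_ite_fst e i₀ 2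
  rw [hprod] at hc
  have h2 := mul_right_cancel₀ (mem_support_iff.mp he) hc
  exact Nat.pow_right_injective (le_refl 2) (by exact_mod_cast h2)

/-- **Column degrees agree in the columns `≥ 1`** (the stabilizing torus
`diag(…, 2, …, 2⁻¹, …)` of `x₁⋯x_d + x₀^d`). [folklore] -/
private theorem colDeg_eq_colDeg (hP : IsPPoly χ P) {e : Fin (n + 2 + 1) × Fin (n + 2 + 1) →₀ ℕ}
    (he : e ∈ P.support) {a b : Fin (n + 2 + 1)} (ha : a ≠ 0) (hb : b ≠ 0) (hab : a ≠ b) :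
    (Finsupp.weight (wRC (n + 2 + 1)) e).2 a = (Finsupp.weight (wRC (n + 2 + 1)) e).2 b := by
  have hid : aeval (fun v : Fin (n + 2 + 1) × Fin (n + 2 + 1) => C (tAB n a b v.2) * X v) P = P := by
    apply MvPolynomial.eq_of_eval_eq_on_gl
    intro g
    rw [eval_aeval_eq]
    have h := hP.torus a b ha hb hab g
    rw [coe_torusElt] at h
    convert h using 2
    congr 1
    funext v
    rw [map_mul, eval_C, eval_X, Matrix.mul_diagonal, mul_comm]
  have hc := congrArg (coeff e) hid
  rw [coeff_aeval_scale] at hc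
  have h1 : (e.prod fun v k => tAB n a b v.2 ^ k) = 1 :=
    mul_right_cancel₀ (mem_support_iff.mp he) (hc.trans (one_mul _).symm)
  have h2 : (e.prod fun v k => tAB n a b v.2 ^ k) =
      (2 : ℂ) ^ (Finsupp.weight (wRC (n + 2 + 1)) e).2 a *
        (2⁻¹ : ℂ) ^ (Finsupp.weight (wRC (n + 2 + 1)) e).2 b := by
    rw [← prod_pow_ite_snd, ← prod_pow_ite_snd, ← Finsupp.prod_mul]
    refine Finsupp.prod_congr fun v _ => ?_
    rw [← mul_pow]
    congr 1
    unfold tAB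
    by_cases ha : v.2 = a
    · rw [if_pos ha, if_pos ha, if_neg (fun h => hab (ha.symm.trans h)), mul_one]
    · rw [if_neg ha, if_neg ha, one_mul]
  rw [h2, inv_pow] at h1
  have h2ne : (2 : ℂ) ^ (Finsupp.weight (wRC (n + 2 + 1)) e).2 b ≠ 0 := pow_ne_zero _ two_ne_zero
  have h3 : (2 : ℂ) ^ (Finsupp.weight (wRC (n + 2 + 1)) e).2 a = (2 : ℂ) ^ (Finsupp.weight (wRC (n + 2 + 1)) e).2 b := by
    calc (2 : ℂ) ^ (Finsupp.weight (wRC (n + 2 + 1)) e).2 a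
        = (2 : ℂ) ^ (Finsupp.weight (wRC (n + 2 + 1)) e).2 a * ((2 : ℂ) ^ (Finsupp.weight (wRC (n + 2 + 1)) e).2 b)⁻¹ *
            (2 : ℂ) ^ (Finsupp.weight (wRC (n + 2 + 1)) e).2 b := by rw [inv_mul_cancel_right₀ h2ne]
      _ = (2 : ℂ) ^ (Finsupp.weight (wRC (n + 2 + 1)) e).2 b := by rw [h1, one_mul]
  exact Nat.pow_right_injective (le_refl 2) (by exact_mod_cast h3)

/-- The semi-invariant is homogeneous for the ROW weight, of degree `ρ`. [folklore] -/
private theorem isWeightedHomogeneous_P_row (hP : IsLPoly χ P) :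
    IsWeightedHomogeneous (fun v : Fin (n + 2 + 1) × Fin (n + 2 + 1) => (wRC (n + 2 + 1) v).1) P (rho n) := by
  intro e he
  have he' : e ∈ P.support := mem_support_iff.mpr he
  funext i
  rw [← rowDeg_eq hP he' i, Finsupp.weight_apply, Finsupp.weight_apply, Finsupp.sum, Finsupp.sum,
    Prod.fst_sum]
  simp only [Finset.sum_apply, Pi.smul_apply, Prod.smul_fst]

/-- The column-difference weight `[j = a] - [j = b]` (an integer). [folklore] -/
def wCol (a b : Fin (n + 2 + 1)) (v : Fin (n + 2 + 1) × Fin (n + 2 + 1)) : ℤ :=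
  (if v.2 = a then 1 else 0) - (if v.2 = b then 1 else 0)

/-- The column-difference weight of a monomial is the difference of the column degrees. [folklore] -/
private theorem weight_wCol (a b : Fin (n + 2 + 1)) (e : Fin (n + 2 + 1) × Fin (n + 2 + 1) →₀ ℕ) :
    Finsupp.weight (wCol (n := n) a b) e =
      ((Finsupp.weight (wRC (n + 2 + 1)) e).2 a : ℤ) - ((Finsupp.weight (wRC (n + 2 + 1)) e).2 b : ℤ) := by
  rw [weight_wRC_snd, weight_wRC_snd, Finsupp.weight_apply, Finsupp.sum]
  push_cast
  rw [← Finset.sum_sub_distrib]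
  refine Finset.sum_congr rfl fun v _ => ?_
  unfold wCol
  split_ifs <;> push_cast <;> ring

/-- The semi-invariant is homogeneous of degree `0` for every column-difference weight with
`a, b ≥ 1`. [folklore] -/
private theorem isWeightedHomogeneous_P_col (hP : IsPPoly χ P) {a b : Fin (n + 2 + 1)} (ha : a ≠ 0) (hb : b ≠ 0) :
    IsWeightedHomogeneous (wCol (n := n) a b) P (0 : ℤ) := by
  intro e he
  have he' : e ∈ P.support := mem_support_iff.mpr he
  rw [weight_wCol]
  by_cases hab : a = b
  · rw [hab, sub_self]
  · rw [colDeg_eq_colDeg hP he' ha hb hab, sub_self]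

/-- The determinant is homogeneous for the row weight, of degree `(1, …, 1)`. [folklore] -/
private theorem isWeightedHomogeneous_det_row :
    IsWeightedHomogeneous (fun v : Fin (n + 2 + 1) × Fin (n + 2 + 1) => (wRC (n + 2 + 1) v).1) (ZZ n).det
      (fun _ => 1 : Fin (n + 2 + 1) → ℕ) := by
  rw [Matrix.det_apply]
  refine IsWeightedHomogeneous.sum _ _ _ fun σ _ => ?_
  have hprod : IsWeightedHomogeneous (fun v : Fin (n + 2 + 1) × Fin (n + 2 + 1) => (wRC (n + 2 + 1) v).1)
      (∏ i, (ZZ n) (σ i) i) (∑ i, (wRC (n + 2 + 1) (σ i, i)).1) :=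
    IsWeightedHomogeneous.prod _ _ _ fun i _ => by
      show IsWeightedHomogeneous _ (X (σ i, i)) _
      exact isWeightedHomogeneous_X _ _ _
  have hsum : ∑ i, (wRC (n + 2 + 1) (σ i, i)).1 = (fun _ => 1 : Fin (n + 2 + 1) → ℕ) := by
    funext i'
    rw [Finset.sum_apply]
    simp only [wRC]
    rw [Equiv.sum_comp σ (fun i => if i = i' then 1 else 0)]
    simp
  rw [hsum] at hprod
  rw [Units.smul_def]
  exact zsmul_mem (show _ ∈ weightedHomogeneousSubmodule ℂ _ _ from hprod) _

/-- The determinant is homogeneous of degree `0` for every column-difference weight. [folklore] -/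
private theorem isWeightedHomogeneous_det_col (a b : Fin (n + 2 + 1)) :
    IsWeightedHomogeneous (wCol (n := n) a b) (ZZ n).det (0 : ℤ) := by
  rw [Matrix.det_apply]
  refine IsWeightedHomogeneous.sum _ _ _ fun σ _ => ?_
  have hprod : IsWeightedHomogeneous (wCol (n := n) a b) (∏ i, (ZZ n) (σ i) i) (∑ i, wCol (n := n) a b (σ i, i)) :=
    IsWeightedHomogeneous.prod _ _ _ fun i _ => by
      show IsWeightedHomogeneous _ (X (σ i, i)) _
      exact isWeightedHomogeneous_X _ _ _
  have hsum : ∑ i, wCol (n := n) a b (σ i, i) = 0 := by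
    simp only [wCol]
    rw [Finset.sum_sub_distrib]
    simp
  rw [hsum] at hprod
  rw [Units.smul_def]
  exact zsmul_mem (show _ ∈ weightedHomogeneousSubmodule ℂ _ _ from hprod) _

/-- Values of `δ` at a matrix. [folklore] -/
private theorem eval_dMinor (G : Matrix (Fin (n + 2 + 1)) (Fin (n + 2 + 1)) ℂ) :
    eval (fun ij : Fin (n + 2 + 1) × Fin (n + 2 + 1) => G ij.1 ij.2) (dMinor n) =
      (G.submatrix Fin.succ Fin.succ).det := by
  rw [dMinor, RingHom.map_det]
  congr 1
  ext i j
  simp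

/-- `δ ≠ 0` (its value at the identity matrix is `1`). [folklore] -/
private theorem dMinor_ne_zero : dMinor n ≠ 0 := by
  intro h
  have h1 := eval_dMinor (n := n) (1 : Matrix (Fin (n + 2 + 1)) (Fin (n + 2 + 1)) ℂ)
  have hsub : (1 : Matrix (Fin (n + 2 + 1)) (Fin (n + 2 + 1)) ℂ).submatrix Fin.succ Fin.succ = 1 := by
    ext i j
    simp [Matrix.one_apply, Fin.succ_inj]
  rw [h, map_zero, hsub, Matrix.det_one] at h1
  exact zero_ne_one h1

/-- `det Z ∤ δ` (at `diag(0, 1, …, 1)` the determinant vanishes but `δ = 1`). [folklore] -/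
private theorem det_not_dvd_dMinor : ¬ (ZZ n).det ∣ dMinor n := by
  rintro ⟨q, hq⟩
  set G : Matrix (Fin (n + 2 + 1)) (Fin (n + 2 + 1)) ℂ := Matrix.diagonal fun i => if i = 0 then 0 else 1 with hG
  have h1 := eval_dMinor (n := n) G
  have hsub : G.submatrix Fin.succ Fin.succ = 1 := by
    ext i j
    rw [Matrix.submatrix_apply, hG, Matrix.diagonal_apply, Matrix.one_apply]
    simp only [Fin.succ_inj, if_neg (Fin.succ_ne_zero i)]
  have hdet : eval (fun ij : Fin (n + 2 + 1) × Fin (n + 2 + 1) => G ij.1 ij.2) (ZZ n).det = 0 := by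
    rw [Matrix.eval_det_mvPolynomialX]
    have : (Matrix.of fun i j => G i j) = G := rfl
    rw [this, hG, Matrix.det_diagonal]
    exact Finset.prod_eq_zero (Finset.mem_univ (0 : Fin (n + 2 + 1))) (by simp)
  rw [hsub, Matrix.det_one, hq, map_mul, hdet, zero_mul] at h1
  exact one_ne_zero h1.symm

/-- `M₁ = M₀` with the row `0` scaled by `det Z`; the scaling identity. [folklore] -/
private theorem aeval_M1_eq (hP : IsLPoly χ P) :
    aeval (fun v : Fin (n + 2 + 1) × Fin (n + 2 + 1) => if v.1 = 0 then (ZZ n).det * M0 n v else M0 n v) P =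
      (ZZ n).det ^ rr n * aeval (M0 n) P :=
  aeval_rowScale P 0 (rr n) (fun e he => by rw [rowDeg_eq hP he 0, rho_zero]) (M0 n) (ZZ n).det

/-- **The elimination step, pointwise**: at an invertible `g` with `δ(g) ≠ 0`,
`P([det g · e_0; g_1; …; g_{N-1}]) = δ(g)^{10d} P(g)`: the matrix `[det g · e_0; g_1; …] g⁻¹` is
upper triangular with diagonal `(δ(g), 1, …, 1)`. [cite: IkenmeyerKandasamy2019, Thm. 4.3 (second bullet)] -/
private theorem eval_M1 (hP : IsLPoly χ P) (g : GL (Fin (n + 2 + 1)) ℂ)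
    (hδ : (((g : Matrix (Fin (n + 2 + 1)) (Fin (n + 2 + 1)) ℂ)).submatrix Fin.succ Fin.succ).det ≠ 0) :
    eval (fun ij : Fin (n + 2 + 1) × Fin (n + 2 + 1) => (g : Matrix (Fin (n + 2 + 1)) (Fin (n + 2 + 1)) ℂ) ij.1 ij.2)
        (aeval (fun v : Fin (n + 2 + 1) × Fin (n + 2 + 1) =>
          if v.1 = 0 then (ZZ n).det * M0 n v else M0 n v) P) =
      (((g : Matrix (Fin (n + 2 + 1)) (Fin (n + 2 + 1)) ℂ)).submatrix Fin.succ Fin.succ).det ^ rr n *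
        eval (fun ij : Fin (n + 2 + 1) × Fin (n + 2 + 1) => (g : Matrix (Fin (n + 2 + 1)) (Fin (n + 2 + 1)) ℂ) ij.1 ij.2) P := by
  set G : Matrix (Fin (n + 2 + 1)) (Fin (n + 2 + 1)) ℂ := (g : Matrix (Fin (n + 2 + 1)) (Fin (n + 2 + 1)) ℂ) with hG
  set δ : ℂ := (G.submatrix Fin.succ Fin.succ).det with hδdef
  set Mg : Matrix (Fin (n + 2 + 1)) (Fin (n + 2 + 1)) ℂ :=
    Matrix.of fun i j => if i = 0 then (if j = 0 then G.det else 0) else G i j with hMg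
  have hevalM : (fun v : Fin (n + 2 + 1) × Fin (n + 2 + 1) => eval (fun ij : Fin (n + 2 + 1) × Fin (n + 2 + 1) => G ij.1 ij.2)
      (if v.1 = 0 then (ZZ n).det * M0 n v else M0 n v)) = fun v => Mg v.1 v.2 := by
    funext v
    rw [hMg, Matrix.of_apply]
    unfold M0
    have hdet : eval (fun ij : Fin (n + 2 + 1) × Fin (n + 2 + 1) => G ij.1 ij.2) (ZZ n).det = G.det := by
      rw [Matrix.eval_det_mvPolynomialX]; rfl
    split_ifs <;> simp [hdet]
  rw [eval_aeval_eq, hevalM]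
  have hunit : IsUnit G.det := (Matrix.isUnit_iff_isUnit_det _).mp (Units.isUnit g)
  have hGinv : G * G⁻¹ = 1 := Matrix.mul_nonsing_inv G hunit
  have hrow : ∀ i, i ≠ 0 → ∀ j, (Mg * G⁻¹) i j = (1 : Matrix (Fin (n + 2 + 1)) (Fin (n + 2 + 1)) ℂ) i j := by
    intro i hi j
    rw [← hGinv, Matrix.mul_apply, Matrix.mul_apply]
    refine Finset.sum_congr rfl fun l _ => ?_
    rw [hMg, Matrix.of_apply, if_neg hi]
  have h00 : (Mg * G⁻¹) 0 0 = δ := by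
    rw [Matrix.mul_apply]
    have hterm : ∀ l, Mg 0 l * G⁻¹ l 0 = if l = 0 then G.det * G⁻¹ 0 0 else 0 := by
      intro l
      rw [hMg, Matrix.of_apply, if_pos rfl]
      split_ifs with hl
      · rw [hl]
      · rw [zero_mul]
    rw [Finset.sum_congr rfl fun l _ => hterm l, Finset.sum_ite_eq' Finset.univ, if_pos (Finset.mem_univ _),
      Matrix.inv_def, Matrix.smul_apply, Ring.inverse_eq_inv, smul_eq_mul, ← mul_assoc,
      mul_inv_cancel₀ hunit.ne_zero, one_mul, Matrix.adjugate_fin_succ_eq_det_submatrix,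
      Fin.succAbove_zero]
    simp [hδdef]
  have htri : (Mg * G⁻¹).BlockTriangular id := by
    intro i j hij
    have hi : i ≠ 0 := by
      rintro rfl
      exact absurd hij (not_lt.mpr (Fin.zero_le _))
    have hij' : j < i := hij
    rw [hrow i hi j, Matrix.one_apply, if_neg (ne_of_lt hij').symm]
  have hdiag : ∀ i, i ≠ 0 → (Mg * G⁻¹) i i = 1 := fun i hi => by
    rw [hrow i hi i, Matrix.one_apply_eq]
  have hdetb : (Mg * G⁻¹).det = δ := by
    rw [Matrix.det_of_upperTriangular htri, Fin.prod_univ_succ, h00,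
      Finset.prod_eq_one fun i _ => hdiag _ (Fin.succ_ne_zero i), mul_one]
  set b : GL (Fin (n + 2 + 1)) ℂ := Matrix.GeneralLinearGroup.mkOfDetNeZero (Mg * G⁻¹) (by rw [hdetb]; exact hδ)
    with hb
  have hbval : (b : Matrix (Fin (n + 2 + 1)) (Fin (n + 2 + 1)) ℂ) = Mg * G⁻¹ :=
    Matrix.GeneralLinearGroup.val_mkOfDetNeZero _ _
  have hbtri : IsUpperTriangular b := by
    show (b : Matrix (Fin (n + 2 + 1)) (Fin (n + 2 + 1)) ℂ).BlockTriangular id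
    rw [hbval]; exact htri
  have hbg : (b : Matrix (Fin (n + 2 + 1)) (Fin (n + 2 + 1)) ℂ) * G = Mg := by
    rw [hbval, Matrix.nonsing_inv_mul_cancel_right G Mg hunit]
  have hwc : weightChar χ b = δ ^ (χ 0) := by
    unfold weightChar
    rw [Fin.prod_univ_succ, hbval, h00,
      Finset.prod_eq_one fun i _ => by rw [hdiag _ (Fin.succ_ne_zero i), one_zpow], mul_one]
  have hchi0 : χ 0 = -((rr n : ℕ) : ℤ) := by rw [hP.chi 0, rho_zero]
  have h := hP.left b hbtri g
  simp only [← hG] at h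
  rw [hbg, hwc, hchi0, zpow_neg, inv_inv, zpow_natCast] at h
  exact h

/-- **`det(Z)^{10d}` divides `δ^{10d} P`**: `δ^{10d} P = det^{10d} · P(M₀)` as polynomials (both sides
times `δ` agree on `GL_N`, which is Zariski dense; `δ ≠ 0`). [cite: IkenmeyerKandasamy2019, Thm. 4.3 (second bullet)] -/
private theorem det_pow_dvd (hP : IsLPoly χ P) :
    (ZZ n).det ^ rr n ∣ dMinor n ^ rr n * P := by
  have key : dMinor n * (aeval (fun v : Fin (n + 2 + 1) × Fin (n + 2 + 1) =>
      if v.1 = 0 then (ZZ n).det * M0 n v else M0 n v) P - dMinor n ^ rr n * P) = 0 := by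
    apply MvPolynomial.eq_of_eval_eq_on_gl
    intro g
    rw [map_zero, map_mul]
    by_cases hδ : (((g : Matrix (Fin (n + 2 + 1)) (Fin (n + 2 + 1)) ℂ)).submatrix Fin.succ Fin.succ).det = 0
    · rw [eval_dMinor, hδ, zero_mul]
    · rw [map_sub, map_mul, map_pow, eval_M1 hP g hδ, eval_dMinor, sub_self, mul_zero]
  rw [mul_sub, sub_eq_zero] at key
  have h2 := mul_left_cancel₀ (dMinor_ne_zero (n := n)) key
  rw [aeval_M1_eq hP] at h2
  exact ⟨aeval (M0 n) P, h2.symm⟩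

/-- **The determinant factor**: `P = det(Z)^{10d} · P₁`. [cite: IkenmeyerKandasamy2019, Thm. 4.3 (second bullet)] -/
private theorem exists_eq_det_pow_mul (hP : IsLPoly χ P) : ∃ P₁ : Rm n, P = (ZZ n).det ^ rr n * P₁ := by
  have hprime : Prime (ZZ n).det :=
    prime_det_of_X (k := ℂ) (ι := fun ij : Fin (n + 2 + 1) × Fin (n + 2 + 1) => ij) fun _ _ h => h
  exact hprime.pow_dvd_of_dvd_mul_left _ (fun h => det_not_dvd_dMinor (hprime.dvd_of_dvd_pow h))
    (det_pow_dvd hP)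

/-! ### §4 The quotient `P₁ = P / det^{10d}`: inherited homogeneity and symmetries -/

/-- Values of `det Z` at a matrix. [folklore] -/
private theorem eval_det (G : Matrix (Fin (n + 2 + 1)) (Fin (n + 2 + 1)) ℂ) :
    eval (fun ij : Fin (n + 2 + 1) × Fin (n + 2 + 1) => G ij.1 ij.2) (ZZ n).det = G.det := by
  rw [Matrix.eval_det_mvPolynomialX]; rfl

variable {P₁ : Rm n}

/-- `P₁` is homogeneous for the row weight, of degree `ρ' = (0, …, 0, 1, 5d-1)`. [folklore] -/
private theorem isWeightedHomogeneous_P1_row (hP : IsLPoly χ P) (h1 : P = (ZZ n).det ^ rr n * P₁) :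
    IsWeightedHomogeneous (fun v : Fin (n + 2 + 1) × Fin (n + 2 + 1) => (wRC (n + 2 + 1) v).1) P₁ (rho1 n) := by
  have hdet0 : (ZZ n).det ^ rr n ≠ 0 :=
    pow_ne_zero _ (Matrix.det_mvPolynomialX_ne_zero (Fin (n + 2 + 1)) ℂ)
  have hhomD : IsWeightedHomogeneous (fun v : Fin (n + 2 + 1) × Fin (n + 2 + 1) => (wRC (n + 2 + 1) v).1)
      ((ZZ n).det ^ rr n) (rr n • (fun _ => 1 : Fin (n + 2 + 1) → ℕ)) :=
    (isWeightedHomogeneous_det_row (n := n)).pow _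
  refine isWeightedHomogeneous_of_mul hhomD hdet0 (h1 ▸ isWeightedHomogeneous_P_row hP) ?_
  funext i
  simp only [Pi.add_apply, Pi.smul_apply, smul_eq_mul, mul_one]
  exact (rho_eq_add i).symm

/-- `P₁` is homogeneous of degree `0` for every column-difference weight with `a, b ≥ 1`.
[folklore] -/
private theorem isWeightedHomogeneous_P1_col (hP : IsPPoly χ P) (h1 : P = (ZZ n).det ^ rr n * P₁)
    {a b : Fin (n + 2 + 1)} (ha : a ≠ 0) (hb : b ≠ 0) :
    IsWeightedHomogeneous (wCol (n := n) a b) P₁ (0 : ℤ) := by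
  have hdet0 : (ZZ n).det ^ rr n ≠ 0 :=
    pow_ne_zero _ (Matrix.det_mvPolynomialX_ne_zero (Fin (n + 2 + 1)) ℂ)
  have hhomD : IsWeightedHomogeneous (wCol (n := n) a b) ((ZZ n).det ^ rr n) (rr n • (0 : ℤ)) :=
    (isWeightedHomogeneous_det_col (n := n) a b).pow _
  rw [smul_zero] at hhomD
  exact isWeightedHomogeneous_of_mul hhomD hdet0 (h1 ▸ isWeightedHomogeneous_P_col hP ha hb) (zero_add 0)

/-- **Transfer of identities from `P` to `P₁`**: if `P(H) = P(G)` with `det(H)^{10d} = det(G)^{10d} ≠ 0`,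
then `P₁(H) = P₁(G)`. [folklore] -/
private theorem eval_P1_eq (h1 : P = (ZZ n).det ^ rr n * P₁) {G H : Matrix (Fin (n + 2 + 1)) (Fin (n + 2 + 1)) ℂ}
    (hG : G.det ≠ 0) (hdet : H.det ^ rr n = G.det ^ rr n)
    (hPeq : eval (fun ij : Fin (n + 2 + 1) × Fin (n + 2 + 1) => H ij.1 ij.2) P =
      eval (fun ij : Fin (n + 2 + 1) × Fin (n + 2 + 1) => G ij.1 ij.2) P) :
    eval (fun ij : Fin (n + 2 + 1) × Fin (n + 2 + 1) => H ij.1 ij.2) P₁ =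
      eval (fun ij : Fin (n + 2 + 1) × Fin (n + 2 + 1) => G ij.1 ij.2) P₁ := by
  rw [h1, map_mul, map_mul, map_pow, map_pow, eval_det, eval_det, hdet] at hPeq
  exact mul_left_cancel₀ (pow_ne_zero _ hG) hPeq

/-- **Column permutations fixing `0` preserve `P₁`** (`det(g τ) = ± det(g)` and `10d` is even —
the paper's "even number of columns"). [cite: DuttaGesmundoIkenmeyerJindalLysikovJSC2025, Prop. 4.11] -/
private theorem rename_perm_P1 (h1 : P = (ZZ n).det ^ rr n * P₁) (τ : Equiv.Perm (Fin (n + 2 + 1)))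
    (hperm : ∀ g : GL (Fin (n + 2 + 1)) ℂ,
      eval (fun ij : Fin (n + 2 + 1) × Fin (n + 2 + 1) =>
          ((g : Matrix (Fin (n + 2 + 1)) (Fin (n + 2 + 1)) ℂ) * (τ⁻¹).permMatrix ℂ) ij.1 ij.2) P =
        eval (fun ij : Fin (n + 2 + 1) × Fin (n + 2 + 1) =>
          (g : Matrix (Fin (n + 2 + 1)) (Fin (n + 2 + 1)) ℂ) ij.1 ij.2) P) :
    rename (fun v : Fin (n + 2 + 1) × Fin (n + 2 + 1) => (v.1, τ v.2)) P₁ = P₁ := by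
  apply MvPolynomial.eq_of_eval_eq_on_gl
  intro g
  rw [eval_rename]
  have hmat : (g : Matrix (Fin (n + 2 + 1)) (Fin (n + 2 + 1)) ℂ) * (τ⁻¹).permMatrix ℂ =
      (g : Matrix (Fin (n + 2 + 1)) (Fin (n + 2 + 1)) ℂ).submatrix id τ := by
    rw [show (τ⁻¹).permMatrix ℂ = (τ⁻¹).toPEquiv.toMatrix from rfl, PEquiv.mul_toMatrix_toPEquiv,
      Equiv.Perm.inv_def, Equiv.symm_symm]
  have hfun : (fun ij : Fin (n + 2 + 1) × Fin (n + 2 + 1) =>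
      (g : Matrix (Fin (n + 2 + 1)) (Fin (n + 2 + 1)) ℂ) ij.1 ij.2) ∘
      (fun v : Fin (n + 2 + 1) × Fin (n + 2 + 1) => (v.1, τ v.2)) =
      fun ij : Fin (n + 2 + 1) × Fin (n + 2 + 1) =>
        ((g : Matrix (Fin (n + 2 + 1)) (Fin (n + 2 + 1)) ℂ) * (τ⁻¹).permMatrix ℂ) ij.1 ij.2 := by
    funext v
    rw [hmat]
    rfl
  rw [hfun]
  have hGdet : (g : Matrix (Fin (n + 2 + 1)) (Fin (n + 2 + 1)) ℂ).det ≠ 0 :=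
    (Matrix.isUnit_iff_isUnit_det _).mp (Units.isUnit g) |>.ne_zero
  refine eval_P1_eq h1 hGdet ?_ (hperm g)
  rw [Matrix.det_mul, Matrix.det_permutation, mul_pow]
  have hs : (((Equiv.Perm.sign τ⁻¹ : ℤˣ) : ℤ) : ℂ) ^ rr n = 1 := by
    have heven : Even (rr n) := ⟨5 * (n + 2), by rw [rr_def]; ring⟩
    rcases Int.units_eq_one_or (Equiv.Perm.sign τ⁻¹) with h | h
    · rw [h]; simp
    · rw [h]; push_cast; exact heven.neg_one_pow
  rw [hs, mul_one]

/-- **The raising operator preserves `P₁`**: `P₁(z_{d-1} + z_d, z_d) = P₁` (left multiplication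
by the unipotent `1 + E_{d-1,d}`, on which the character `χ` is trivial).
[cite: DuttaGesmundoIkenmeyerJindalLysikovJSC2025, Prop. 4.11] -/
private theorem aeval_theta_P1 (hP : IsLPoly χ P) (h1 : P = (ZZ n).det ^ rr n * P₁) :
    aeval (theta n) P₁ = P₁ := by
  apply MvPolynomial.eq_of_eval_eq_on_gl
  intro g
  rw [eval_aeval_eq]
  have hfun : (fun v : Fin (n + 2 + 1) × Fin (n + 2 + 1) =>
      eval (fun ij : Fin (n + 2 + 1) × Fin (n + 2 + 1) =>
        (g : Matrix (Fin (n + 2 + 1)) (Fin (n + 2 + 1)) ℂ) ij.1 ij.2) (theta n v)) =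
      fun ij : Fin (n + 2 + 1) × Fin (n + 2 + 1) =>
        (Matrix.transvection (iA n) (iB n) (1 : ℂ) *
          (g : Matrix (Fin (n + 2 + 1)) (Fin (n + 2 + 1)) ℂ)) ij.1 ij.2 := by
    funext ⟨i, j⟩
    unfold theta
    dsimp only
    by_cases hv : i = iA n
    · rw [if_pos hv, map_add, eval_X, eval_X, hv, Matrix.transvection_mul_apply_same, one_mul]
    · rw [if_neg hv, eval_X, Matrix.transvection_mul_apply_of_ne (ha := hv)]
  rw [hfun]
  have hGdet : (g : Matrix (Fin (n + 2 + 1)) (Fin (n + 2 + 1)) ℂ).det ≠ 0 :=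
    (Matrix.isUnit_iff_isUnit_det _).mp (Units.isUnit g) |>.ne_zero
  refine eval_P1_eq h1 hGdet ?_ ?_
  · rw [Matrix.det_mul, Matrix.det_transvection_of_ne (h := iA_ne_iB), one_mul]
  · have htri : IsUpperTriangular (Tg n) := by
      show ((Tg n : GL (Fin (n + 2 + 1)) ℂ) : Matrix (Fin (n + 2 + 1)) (Fin (n + 2 + 1)) ℂ).BlockTriangular id
      rw [coe_Tg]
      exact Matrix.blockTriangular_transvection
        (by show iA n ≤ iB n; unfold iA iB; exact Fin.mk_le_mk.mpr (by omega)) _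
    have hwc : weightChar χ (Tg n) = 1 := by
      unfold weightChar
      refine Finset.prod_eq_one fun i _ => ?_
      have hne : ¬(iA n = i ∧ iB n = i) := fun h => iA_ne_iB (h.1.trans h.2.symm)
      simp only [coe_Tg, Matrix.transvection, Matrix.add_apply, Matrix.one_apply_eq,
        Matrix.single_apply, if_neg hne, add_zero, one_zpow]
    have h := hP.left (Tg n) htri g
    rw [hwc, inv_one, one_mul, coe_Tg] at h
    exact h

/-! ### §5 Exponents on the last two rows -/

/-- Values of `rowExp`. [folklore] -/
private theorem rowExp_apply (i : Fin (n + 2 + 1)) (f : Fin (n + 2 + 1) →₀ ℕ) (i' j : Fin (n + 2 + 1)) :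
    rowExp n i f (i', j) = if i' = i then f j else 0 := by
  unfold rowExp
  split_ifs with h
  · rw [h]
    exact Finsupp.mapDomain_apply (Prod.mk_right_injective i) f j
  · exact Finsupp.mapDomain_notin_range _ _ (by rintro ⟨j', hj'⟩; exact h (Prod.mk.inj hj').1.symm)

/-- Values of `eps` on the row `d - 1`. [folklore] -/
private theorem eps_apply_iA (j : Fin (n + 2 + 1)) (f : Fin (n + 2 + 1) →₀ ℕ) (j' : Fin (n + 2 + 1)) :
    eps n j f (iA n, j') = if j' = j then 1 else 0 := by
  unfold eps
  rw [Finsupp.add_apply, rowExp_apply, if_neg iA_ne_iB, add_zero, Finsupp.single_apply]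
  by_cases h : j' = j
  · rw [if_pos h, if_pos (by rw [h])]
  · rw [if_neg h, if_neg (fun h' => h (Prod.mk.inj h').2.symm)]

/-- Values of `eps` on the row `d`. [folklore] -/
private theorem eps_apply_iB (j : Fin (n + 2 + 1)) (f : Fin (n + 2 + 1) →₀ ℕ) (j' : Fin (n + 2 + 1)) :
    eps n j f (iB n, j') = f j' := by
  unfold eps
  rw [Finsupp.add_apply, rowExp_apply, if_pos rfl, Finsupp.single_apply,
    if_neg (fun h' => iA_ne_iB (Prod.mk.inj h').1), zero_add]

/-- Values of `eps` off the last two rows. [folklore] -/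
private theorem eps_apply_of_ne (j : Fin (n + 2 + 1)) (f : Fin (n + 2 + 1) →₀ ℕ) {i' : Fin (n + 2 + 1)}
    (hA : i' ≠ iA n) (hB : i' ≠ iB n) (j' : Fin (n + 2 + 1)) : eps n j f (i', j') = 0 := by
  unfold eps
  rw [Finsupp.add_apply, rowExp_apply, if_neg hB, Finsupp.single_apply,
    if_neg (fun h' => hA (Prod.mk.inj h').1.symm), zero_add]

/-- `eps j f` determines `j`. [folklore] -/
private theorem eps_inj_left {j₁ j₂ : Fin (n + 2 + 1)} {f₁ f₂ : Fin (n + 2 + 1) →₀ ℕ}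
    (h : eps n j₁ f₁ = eps n j₂ f₂) : j₁ = j₂ := by
  have h1 := congrArg (fun e => e (iA n, j₁)) h
  simp only [eps_apply_iA] at h1
  by_contra hne
  rw [if_neg hne] at h1
  exact one_ne_zero h1

/-- `eps j f` determines `f`. [folklore] -/
private theorem eps_inj_right {j₁ j₂ : Fin (n + 2 + 1)} {f₁ f₂ : Fin (n + 2 + 1) →₀ ℕ}
    (h : eps n j₁ f₁ = eps n j₂ f₂) : f₁ = f₂ := by
  ext j
  have h1 := congrArg (fun e => e (iB n, j)) h
  simpa only [eps_apply_iB] using h1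

/-- `rowExp` is additive. [folklore] -/
private theorem rowExp_add (i : Fin (n + 2 + 1)) (f g : Fin (n + 2 + 1) →₀ ℕ) :
    rowExp n i (f + g) = rowExp n i f + rowExp n i g :=
  Finsupp.mapDomain_add

/-- `rowExp i (single j 1) = single (i, j) 1`. [folklore] -/
private theorem rowExp_single (i j : Fin (n + 2 + 1)) (c : ℕ) :
    rowExp n i (Finsupp.single j c) = Finsupp.single (i, j) c :=
  Finsupp.mapDomain_single

/-- `rowExp i` is injective. [folklore] -/
private theorem rowExp_injective (i : Fin (n + 2 + 1)) : Function.Injective (rowExp n i) :=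
  Finsupp.mapDomain_injective (Prod.mk_right_injective i)

/-- The row-collapsing map sends `eps j f` to the row-`d` exponent `f + e_j`. [folklore] -/
private theorem mapDomain_piIdx_eps (j : Fin (n + 2 + 1)) (f : Fin (n + 2 + 1) →₀ ℕ) :
    (eps n j f).mapDomain (piIdx n) = rowExp n (iB n) (f + Finsupp.single j 1) := by
  unfold eps
  rw [Finsupp.mapDomain_add, Finsupp.mapDomain_single, rowExp_add, rowExp_single,
    add_comm (Finsupp.single (piIdx n (iA n, j)) 1) _]
  congr 1
  · unfold rowExp
    rw [← Finsupp.mapDomain_comp]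
    congr 1
    funext j'
    simp only [Function.comp_apply, piIdx, if_neg iA_ne_iB.symm]
  · simp only [piIdx, if_true]

/-- The column permutation `τ` sends `eps j f` to `eps (τ j) (f ∘ τ⁻¹)`. [folklore] -/
private theorem mapDomain_perm_eps (τ : Equiv.Perm (Fin (n + 2 + 1))) (j : Fin (n + 2 + 1))
    (f : Fin (n + 2 + 1) →₀ ℕ) :
    (eps n j f).mapDomain (fun v : Fin (n + 2 + 1) × Fin (n + 2 + 1) => (v.1, τ v.2)) =
      eps n (τ j) (f.mapDomain τ) := by
  unfold eps rowExp
  rw [Finsupp.mapDomain_add, Finsupp.mapDomain_single, ← Finsupp.mapDomain_comp,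
    ← Finsupp.mapDomain_comp]
  rfl

/-- The row weight of the product coordinates is the first component of the bi-degree weight.
[folklore] -/
private theorem weight_fst (e : Fin (n + 2 + 1) × Fin (n + 2 + 1) →₀ ℕ) :
    Finsupp.weight (fun v : Fin (n + 2 + 1) × Fin (n + 2 + 1) => (wRC (n + 2 + 1) v).1) e =
      (Finsupp.weight (wRC (n + 2 + 1)) e).1 := by
  rw [Finsupp.weight_apply, Finsupp.weight_apply, Finsupp.sum, Finsupp.sum, Prod.fst_sum]
  rfl

/-- Row degrees as sums over a row. [folklore] -/
private theorem weight_fst_eq_sum (e : Fin (n + 2 + 1) × Fin (n + 2 + 1) →₀ ℕ) (i : Fin (n + 2 + 1)) :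
    (Finsupp.weight (wRC (n + 2 + 1)) e).1 i = ∑ j, e (i, j) := by
  rw [weight_wRC_fst]
  rw [Finset.sum_subset (Finset.subset_univ e.support) (fun v _ hv => by
    rw [Finsupp.notMem_support_iff.mp hv]; split_ifs <;> rfl)]
  rw [Fintype.sum_prod_type, Finset.sum_eq_single i]
  · exact Finset.sum_congr rfl fun j _ => if_pos rfl
  · intro i' _ hi'
    exact Finset.sum_eq_zero fun j _ => if_neg hi'
  · intro h; exact absurd (Finset.mem_univ _) h

/-- Column degrees as sums over a column. [folklore] -/
private theorem weight_snd_eq_sum (e : Fin (n + 2 + 1) × Fin (n + 2 + 1) →₀ ℕ) (j : Fin (n + 2 + 1)) :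
    (Finsupp.weight (wRC (n + 2 + 1)) e).2 j = ∑ i, e (i, j) := by
  rw [weight_wRC_snd]
  rw [Finset.sum_subset (Finset.subset_univ e.support) (fun v _ hv => by
    rw [Finsupp.notMem_support_iff.mp hv]; split_ifs <;> rfl)]
  rw [Fintype.sum_prod_type_right, Finset.sum_eq_single j]
  · exact Finset.sum_congr rfl fun i _ => if_pos rfl
  · intro j' _ hj'
    exact Finset.sum_eq_zero fun i _ => if_neg hj'
  · intro h; exact absurd (Finset.mem_univ _) h

/-- **Shape of the exponents of `P₁`**: an exponent with row degrees `(0, …, 0, 1, *)` is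
`eps j f` — one variable from the row `d - 1`, the rest from the row `d`. [folklore] -/
private theorem exists_eq_eps {e : Fin (n + 2 + 1) × Fin (n + 2 + 1) →₀ ℕ}
    (hw : Finsupp.weight (fun v : Fin (n + 2 + 1) × Fin (n + 2 + 1) => (wRC (n + 2 + 1) v).1) e = rho1 n) :
    ∃ j f, e = eps n j f := by
  rw [weight_fst] at hw
  have hrow : ∀ i, ∑ j, e (i, j) = rho1 n i := fun i => by rw [← weight_fst_eq_sum, hw]
  have hz : ∀ i, i ≠ iA n → i ≠ iB n → ∀ j, e (i, j) = 0 := by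
    intro i hA hB j
    have h := hrow i
    rw [rho1_of_ne hA hB] at h
    exact Finset.sum_eq_zero_iff.mp h j (Finset.mem_univ _)
  have hA : ∑ j, e (iA n, j) = 1 := by rw [hrow, rho1_iA]
  obtain ⟨j, _, hj⟩ := Finset.exists_ne_zero_of_sum_ne_zero (by rw [hA]; exact one_ne_zero)
  have h2 := Finset.add_sum_erase Finset.univ (fun j' => e (iA n, j')) (Finset.mem_univ j)
  rw [hA] at h2
  have hjpos := Nat.pos_of_ne_zero hj
  have hj1 : e (iA n, j) = 1 := by omega
  have hrest : ∑ j' ∈ Finset.univ.erase j, e (iA n, j') = 0 := by omega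
  have hj0 : ∀ j', j' ≠ j → e (iA n, j') = 0 := fun j' hne =>
    Finset.sum_eq_zero_iff.mp hrest j' (Finset.mem_erase.mpr ⟨hne, Finset.mem_univ _⟩)
  refine ⟨j, Finsupp.equivFunOnFinite.symm fun j' => e (iB n, j'), ?_⟩
  ext ⟨i', j'⟩
  by_cases hiA : i' = iA n
  · rw [hiA, eps_apply_iA]
    split_ifs with h
    · rw [h, hj1]
    · exact hj0 j' h
  · by_cases hiB : i' = iB n
    · rw [hiB, eps_apply_iB, Finsupp.coe_equivFunOnFinite_symm]
    · rw [eps_apply_of_ne _ _ hiA hiB, hz i' hiA hiB]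

/-- Substitutions fixing the variables of a monomial fix the monomial. [folklore] -/
private theorem aeval_monomial_of_forall {σ : Type*} (F : σ → MvPolynomial σ ℂ) (e : σ →₀ ℕ) (c : ℂ)
    (h : ∀ v ∈ e.support, F v = X v) : aeval F (monomial e c) = monomial e c := by
  rw [aeval_monomial, monomial_eq, algebraMap_eq]
  congr 1
  exact Finsupp.prod_congr fun v hv => by rw [h v hv]

/-- **The raising substitution on a two-row monomial**:
`θ(z_{d-1,j} z_d^f) = z_{d-1,j} z_d^f + z_{d,j} z_d^f`. [folklore] -/
private theorem aeval_theta_monomial_eps (j : Fin (n + 2 + 1)) (f : Fin (n + 2 + 1) →₀ ℕ) (c : ℂ) :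
    aeval (theta n) (monomial (eps n j f) c) =
      monomial (eps n j f) c + monomial (rowExp n (iB n) (f + Finsupp.single j 1)) c := by
  have hsplit : monomial (eps n j f) c = X (iA n, j) * monomial (rowExp n (iB n) f) c := by
    unfold eps
    rw [X, monomial_mul, one_mul]
  have hfix : aeval (theta n) (monomial (rowExp n (iB n) f) c) = monomial (rowExp n (iB n) f) c := by
    refine aeval_monomial_of_forall _ _ _ fun v hv => ?_
    have hv1 : v.1 = iB n := by
      by_contra hne
      apply Finsupp.mem_support_iff.mp hv
      have h := rowExp_apply (n := n) (iB n) f v.1 v.2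
      rw [if_neg hne] at h
      exact h
    unfold theta
    rw [if_neg (by rw [hv1]; exact iA_ne_iB.symm)]
  rw [hsplit, map_mul, aeval_X, hfix]
  unfold theta
  dsimp only
  rw [if_pos rfl, add_mul, ← hsplit, rowExp_add, rowExp_single, X, monomial_mul, one_mul,
    add_comm (Finsupp.single (iB n, j) 1)]

/-- **Linearity in the row `d - 1`**: for `Q` of row degrees `ρ'`, `θ(Q) = Q + π_*(Q)`, where
`π_*` substitutes the row `d` for the row `d - 1`. [folklore] -/
private theorem aeval_theta_eq {Q : Rm n}
    (hrow : IsWeightedHomogeneous (fun v : Fin (n + 2 + 1) × Fin (n + 2 + 1) => (wRC (n + 2 + 1) v).1) Q (rho1 n)) :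
    aeval (theta n) Q = Q + rename (piIdx n) Q := by
  conv_lhs => rw [Q.as_sum]
  conv_rhs => rw [Q.as_sum]
  rw [map_sum, map_sum, ← Finset.sum_add_distrib]
  refine Finset.sum_congr rfl fun e he => ?_
  obtain ⟨j, f, rfl⟩ := exists_eq_eps (hrow (mem_support_iff.mp he))
  rw [aeval_theta_monomial_eps, rename_monomial, mapDomain_piIdx_eps]

/-- Coefficients of a renamed polynomial. [folklore] -/
private theorem coeff_rename_eq_sum {σ τ : Type*} [DecidableEq τ] (f : σ → τ) (φ : MvPolynomial σ ℂ)
    (d : τ →₀ ℕ) :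
    coeff d (rename f φ) = ∑ u ∈ φ.support, if u.mapDomain f = d then coeff u φ else 0 := by
  conv_lhs => rw [φ.as_sum]
  rw [map_sum, coeff_sum]
  exact Finset.sum_congr rfl fun u _ => by rw [rename_monomial, coeff_monomial]

/-- **The raising relations**: for `Q` of row degrees `ρ'` fixed by `θ` and every row-`d` content
`F`, `∑_{j : F_j ≥ 1} coeff(z_{d-1,j} z_d^{F - e_j}, Q) = 0`. [folklore] -/
private theorem sum_coeff_eps_eq_zero {Q : Rm n}
    (hrow : IsWeightedHomogeneous (fun v : Fin (n + 2 + 1) × Fin (n + 2 + 1) => (wRC (n + 2 + 1) v).1) Q (rho1 n))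
    (hraise : aeval (theta n) Q = Q) (F : Fin (n + 2 + 1) →₀ ℕ) :
    ∑ j ∈ Finset.univ.filter (fun j => F j ≠ 0), coeff (eps n j (F - Finsupp.single j 1)) Q = 0 := by
  have hren : rename (piIdx n) Q = 0 := by
    have h := aeval_theta_eq hrow
    rw [hraise] at h
    exact add_eq_left.mp h.symm
  have h0 : coeff (rowExp n (iB n) F) (rename (piIdx n) Q) = 0 := by rw [hren, coeff_zero]
  rw [coeff_rename_eq_sum] at h0
  rw [← h0]
  have hsub : ∀ j : Fin (n + 2 + 1), F j ≠ 0 → F - Finsupp.single j 1 + Finsupp.single j 1 = F :=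
    fun j hj => tsub_add_cancel_of_le (Finsupp.single_le_iff.mpr (Nat.pos_of_ne_zero hj))
  refine Finset.sum_bij_ne_zero (fun j _ _ => eps n j (F - Finsupp.single j 1)) ?_ ?_ ?_ ?_
  · intro j _ hne
    exact mem_support_iff.mpr hne
  · intro j₁ _ _ j₂ _ _ h
    exact eps_inj_left h
  · intro u hu hne
    obtain ⟨j, f, rfl⟩ := exists_eq_eps (hrow (mem_support_iff.mp hu))
    rw [mapDomain_piIdx_eps] at hne
    have hF : f + Finsupp.single j 1 = F := by
      by_contra h
      exact hne (by rw [if_neg (fun h' => h (rowExp_injective _ h'))])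
    have hFj : F j ≠ 0 := by rw [← hF]; simp
    have hf : F - Finsupp.single j 1 = f := by rw [← hF, add_tsub_cancel_right]
    have hc : rowExp n (iB n) (f + Finsupp.single j 1) = rowExp n (iB n) F := by rw [hF]
    rw [if_pos hc] at hne
    refine ⟨j, Finset.mem_filter.mpr ⟨Finset.mem_univ _, hFj⟩, ?_, by rw [hf]⟩
    rw [hf]
    exact hne
  · intro j hj _
    have hFj := (Finset.mem_filter.mp hj).2
    rw [mapDomain_piIdx_eps, hsub j hFj, if_pos rfl]

/-- **Permutation symmetry of the coefficients**: `coeff(z_{d-1,τj} z_d^{f∘τ⁻¹}, Q) = coeff(z_{d-1,j} z_d^f, Q)`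
for `τ` fixing `0`. [folklore] -/
private theorem coeff_eps_perm {Q : Rm n} (τ : Equiv.Perm (Fin (n + 2 + 1)))
    (hτQ : rename (fun v : Fin (n + 2 + 1) × Fin (n + 2 + 1) => (v.1, τ v.2)) Q = Q)
    (j : Fin (n + 2 + 1)) (f : Fin (n + 2 + 1) →₀ ℕ) :
    coeff (eps n (τ j) (f.mapDomain τ)) Q = coeff (eps n j f) Q := by
  have hinj : Function.Injective (fun v : Fin (n + 2 + 1) × Fin (n + 2 + 1) => (v.1, τ v.2)) := by
    intro v w h
    simp only [Prod.mk.injEq] at h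
    exact Prod.ext h.1 (τ.injective h.2)
  conv_lhs => rw [← hτQ, ← mapDomain_perm_eps]
  exact coeff_rename_mapDomain _ hinj Q _

/-! ### §6 The classification: `P₁` is determined by four coefficients -/

/-- Values of `F_c`. [folklore] -/
private theorem Fc_apply (c : ℕ) (j : Fin (n + 2 + 1)) :
    Fc n c j = if j = 0 then 5 * (n + 2) - (n + 2) * c else c := by
  rw [Fc, Finsupp.coe_equivFunOnFinite_symm]

/-- The hypotheses on the quotient `P₁ = P / det^{10d}` of a semi-invariant in the proof of the upper
bound: row degrees `ρ' = (0, …, 0, 1, 5d-1)`, balanced columns `≥ 1`, invariance under the column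
permutations fixing `0` and under the raising substitution.
[cite: DuttaGesmundoIkenmeyerJindalLysikovJSC2025, Prop. 4.11] -/
structure IsP1Poly (Q : Rm n) : Prop where
  row : IsWeightedHomogeneous (fun v : Fin (n + 2 + 1) × Fin (n + 2 + 1) => (wRC (n + 2 + 1) v).1) Q (rho1 n)
  col : ∀ a b : Fin (n + 2 + 1), a ≠ 0 → b ≠ 0 → IsWeightedHomogeneous (wCol (n := n) a b) Q (0 : ℤ)
  perm : ∀ τ : Equiv.Perm (Fin (n + 2 + 1)), τ 0 = 0 →
    rename (fun v : Fin (n + 2 + 1) × Fin (n + 2 + 1) => (v.1, τ v.2)) Q = Q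
  raise : aeval (theta n) Q = Q

/-- The quotient `P₁ = P / det^{10d}` of a semi-invariant satisfies `IsP1Poly`.
[cite: DuttaGesmundoIkenmeyerJindalLysikovJSC2025, Prop. 4.11] -/
private theorem isP1Poly_of_isPPoly (hP : IsPPoly χ P) (h1 : P = (ZZ n).det ^ rr n * P₁) : IsP1Poly P₁ :=
  ⟨isWeightedHomogeneous_P1_row hP.toL h1, fun _ _ ha hb => isWeightedHomogeneous_P1_col hP h1 ha hb,
    fun τ hτ => rename_perm_P1 h1 τ (hP.perm τ⁻¹ (by
      rw [Equiv.Perm.inv_def, Equiv.symm_apply_eq]; exact hτ.symm)),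
    aeval_theta_P1 hP.toL h1⟩

/-- **Classification**: a polynomial satisfying `IsP1Poly` whose four coefficients
`a_c = coeff(z_{d-1,1} z_d^{F_c - e_1})`, `c = 1, …, 4`, vanish is zero. Every monomial is
`z_{d-1,j} z_d^{F_c - e_j}` with `0 ≤ c ≤ 5`; the raising relation `∑_j a_{c,j} = 0` and the
symmetry `a_{c,1} = ⋯ = a_{c,d}` kill `c = 0` and `c = 5` and tie `a_{c,0}` to `a_{c,1}`.
[cite: DuttaGesmundoIkenmeyerJindalLysikovJSC2025, Prop. 4.11] -/
private theorem eq_zero_of_coeff_eq_zero {Q : Rm n} (hQ : IsP1Poly Q)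
    (h : ∀ c, 1 ≤ c → c ≤ 4 → coeff (eps n 1 (Fc n c - Finsupp.single 1 1)) Q = 0) : Q = 0 := by
  by_contra hQ0
  obtain ⟨e₀, he₀⟩ := ne_zero_iff.mp hQ0
  obtain ⟨j₀, f₀, rfl⟩ := exists_eq_eps (hQ.row he₀)
  set F : Fin (n + 2 + 1) →₀ ℕ := f₀ + Finsupp.single j₀ 1 with hFdef
  -- column degrees of the exponent
  have hcol : ∀ j, (Finsupp.weight (wRC (n + 2 + 1)) (eps n j₀ f₀)).2 j = F j := by
    intro j
    rw [weight_snd_eq_sum, Fintype.sum_eq_add (iA n) (iB n) iA_ne_iB (fun i hi =>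
      eps_apply_of_ne _ _ hi.1 hi.2 _), eps_apply_iA, eps_apply_iB, hFdef, Finsupp.add_apply,
      Finsupp.single_apply, add_comm]
    by_cases hj : j = j₀
    · rw [if_pos hj, if_pos hj.symm]
    · rw [if_neg hj, if_neg (Ne.symm hj)]
  have hab : ∀ a b : Fin (n + 2 + 1), a ≠ 0 → b ≠ 0 → F a = F b := by
    intro a b ha hb
    have h0 := hQ.col a b ha hb he₀
    rw [weight_wCol, hcol, hcol, sub_eq_zero] at h0
    exact_mod_cast h0
  have hsum : ∑ j, F j = 5 * (n + 2) := by
    have h1 : ∑ j, (Finsupp.weight (wRC (n + 2 + 1)) (eps n j₀ f₀)).2 j =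
        ∑ i, (Finsupp.weight (wRC (n + 2 + 1)) (eps n j₀ f₀)).1 i := by
      rw [sum_weight_wRC_snd, sum_weight_wRC_fst]
    simp_rw [hcol] at h1
    rw [h1, ← weight_fst, hQ.row he₀, sum_rho1]
  set c := F 1 with hcdef
  have hFj : ∀ j, j ≠ 0 → F j = c := fun j hj => hab j 1 hj one_ne_zero₃
  have hF0 : F 0 + (n + 2) * c = 5 * (n + 2) := by
    rw [← hsum, ← Finset.add_sum_erase _ _ (Finset.mem_univ (0 : Fin (n + 2 + 1))),
      Finset.sum_congr rfl fun j hj => hFj j (Finset.ne_of_mem_erase hj), Finset.sum_const,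
      Finset.card_erase_of_mem (Finset.mem_univ _), Finset.card_univ, Fintype.card_fin, smul_eq_mul]
    rfl
  have hFc : F = Fc n c := by
    ext j
    rw [Fc_apply]
    by_cases hj : j = 0
    · rw [if_pos hj, hj]; omega
    · rw [if_neg hj, hFj j hj]
  -- the coefficients `a_j`
  set a : Fin (n + 2 + 1) → ℂ := fun j => coeff (eps n j (F - Finsupp.single j 1)) Q with hadef
  have ha_sym : ∀ j j' : Fin (n + 2 + 1), j ≠ 0 → j' ≠ 0 → a j = a j' := by
    intro j j' hj hj'
    by_cases hjj : j = j'
    · rw [hjj]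
    have hswap : (F - Finsupp.single j 1).mapDomain (Equiv.swap j j') = F - Finsupp.single j' 1 := by
      ext b
      rw [Finsupp.mapDomain_equiv_apply, Equiv.symm_swap, Finsupp.tsub_apply, Finsupp.tsub_apply,
        Finsupp.single_apply, Finsupp.single_apply]
      by_cases hb : b = j'
      · rw [hb, Equiv.swap_apply_right, if_pos rfl, if_pos rfl, hFj j hj, hFj j' hj']
      · by_cases hb' : b = j
        · rw [hb', Equiv.swap_apply_left, if_neg (Ne.symm hjj), if_neg hjj, hFj j hj, hFj j' hj']
        · rw [Equiv.swap_apply_of_ne_of_ne hb' hb, if_neg (Ne.symm hb'), if_neg (Ne.symm hb)]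
    have h1 := coeff_eps_perm (Equiv.swap j j')
      (hQ.perm _ (Equiv.swap_apply_of_ne_of_ne hj.symm hj'.symm)) j (F - Finsupp.single j 1)
    rw [Equiv.swap_apply_left, hswap] at h1
    exact h1.symm
  have hrel := sum_coeff_eps_eq_zero hQ.row hQ.raise F
  have hcoef : coeff (eps n j₀ f₀) Q = a j₀ := by
    simp only [hadef, hFdef, add_tsub_cancel_right]
  have hFj₀ : F j₀ ≠ 0 := by simp [hFdef]
  rcases Nat.lt_or_ge c 5 with hc5 | hc5
  · rcases Nat.eq_zero_or_pos c with hc0 | hc1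
    · -- `c = 0`: only the column `0` is populated, and the raising relation kills it
      have hj₀ : j₀ = 0 := by
        by_contra hne
        exact hFj₀ (by rw [hFj j₀ hne, hc0])
      have hfilter : Finset.univ.filter (fun j => F j ≠ 0) = {0} := by
        ext j
        simp only [Finset.mem_filter, Finset.mem_univ, true_and, Finset.mem_singleton]
        constructor
        · intro hj
          by_contra hne
          exact hj (by rw [hFj j hne, hc0])
        · intro hj
          have : (n + 2) * c = 0 := by rw [hc0, mul_zero]
          rw [hj]; omega
      rw [hfilter, Finset.sum_singleton] at hrel
      exact he₀ (by rw [hcoef, hj₀]; exact hrel)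
    · -- `1 ≤ c ≤ 4`: `a_1 = 0` by hypothesis, hence all `a_j = 0`
      have ha1 : a 1 = 0 := by
        show coeff (eps n 1 (F - Finsupp.single 1 1)) Q = 0
        rw [hFc]
        exact h c hc1 (by omega)
      have haj : ∀ j, j ≠ 0 → a j = 0 := fun j hj => (ha_sym j 1 hj one_ne_zero₃).trans ha1
      have hfilter : Finset.univ.filter (fun j => F j ≠ 0) = Finset.univ := by
        refine Finset.filter_true_of_mem fun j _ => ?_
        by_cases hj : j = 0
        · rw [hj]
          have : (n + 2) * c ≤ (n + 2) * 4 := Nat.mul_le_mul_left _ (by omega)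
          omega
        · rw [hFj j hj]; omega
      rw [hfilter, ← Finset.add_sum_erase _ _ (Finset.mem_univ (0 : Fin (n + 2 + 1))),
        Finset.sum_eq_zero (fun j hj => haj j (Finset.ne_of_mem_erase hj)), add_zero] at hrel
      have hj₀ : a j₀ = 0 := by
        by_cases hj : j₀ = 0
        · rw [hj]; exact hrel
        · exact haj j₀ hj
      exact he₀ (hcoef.trans hj₀)
  · -- `c ≥ 5`: then `c = 5`, the column `0` is empty, and `d · a_1 = 0`
    have hc : c = 5 ∧ F 0 = 0 := by
      have h1 : (n + 2) * c ≤ (n + 2) * 5 := by rw [mul_comm (n + 2) 5]; omega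
      have h2 : c ≤ 5 := Nat.le_of_mul_le_mul_left h1 (by omega)
      have h3 : c = 5 := le_antisymm h2 hc5
      refine ⟨h3, ?_⟩
      rw [h3] at hF0
      omega
    have hj₀ : j₀ ≠ 0 := fun hj => hFj₀ (by rw [hj]; exact hc.2)
    have hfilter : Finset.univ.filter (fun j => F j ≠ 0) = Finset.univ.erase 0 := by
      ext j
      simp only [Finset.mem_filter, Finset.mem_univ, true_and, Finset.mem_erase, and_true]
      constructor
      · intro hj h0
        exact hj (by rw [h0]; exact hc.2)
      · intro hj
        rw [hFj j hj, hc.1]; omega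
    rw [hfilter, Finset.sum_congr rfl (fun j hj => ha_sym j j₀ (Finset.ne_of_mem_erase hj) hj₀),
      Finset.sum_const, Finset.card_erase_of_mem (Finset.mem_univ _), Finset.card_univ,
      Fintype.card_fin, nsmul_eq_mul] at hrel
    have hd : ((n + 2 + 1 - 1 : ℕ) : ℂ) ≠ 0 := by exact_mod_cast (show n + 2 + 1 - 1 ≠ 0 by omega)
    have hj₀' : a j₀ = 0 := (mul_eq_zero.mp hrel).resolve_left hd
    exact he₀ (hcoef.trans hj₀')

/-- The linear map extracting the four coefficients `a_c`, `c = 1, …, 4`. [folklore] -/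
def coeff4 (n : ℕ) : Rm n →ₗ[ℂ] (Fin 4 → ℂ) :=
  LinearMap.pi fun c : Fin 4 => lcoeff ℂ (eps n 1 (Fc n ((c : ℕ) + 1) - Finsupp.single 1 1))

/-- **At most four dimensions**: a subspace of `ℂ[Mat_{d+1}]` all of whose members satisfy
`IsPPoly` has dimension `≤ 4` (divide by `det^{10d}` and extract the four coefficients:
an injective linear map to `ℂ^4`). [cite: DuttaGesmundoIkenmeyerJindalLysikovJSC2025, Prop. 4.11] -/
private theorem finrank_le_four_of_forall_isPPoly (V : Submodule ℂ (Rm n))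
    (hV : ∀ P ∈ V, IsPPoly χ P) : Module.finrank ℂ V ≤ 4 := by
  set D : Rm n := (ZZ n).det ^ rr n with hDdef
  have hD : D ≠ 0 := pow_ne_zero _ (Matrix.det_mvPolynomialX_ne_zero (Fin (n + 2 + 1)) ℂ)
  have hinj : Function.Injective (LinearMap.mulLeft ℂ D) := fun x y hxy => mul_left_cancel₀ hD hxy
  have hle : V ≤ LinearMap.range (LinearMap.mulLeft ℂ D) := by
    intro P hP
    obtain ⟨P₁, h1⟩ := exists_eq_det_pow_mul (hV P hP).toL
    exact ⟨P₁, h1.symm⟩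
  let Φ : V →ₗ[ℂ] Rm n :=
    (LinearEquiv.ofInjective _ hinj).symm.toLinearMap ∘ₗ Submodule.inclusion hle
  have hΦ : ∀ p : V, D * Φ p = (p : Rm n) := fun p => by
    show LinearMap.mulLeft ℂ D ((LinearEquiv.ofInjective _ hinj).symm (Submodule.inclusion hle p)) = _
    rw [LinearEquiv.ofInjective_symm_apply]
    rfl
  let Ψ : V →ₗ[ℂ] (Fin 4 → ℂ) := coeff4 n ∘ₗ Φ
  have hΨ : Function.Injective Ψ := by
    rw [← LinearMap.ker_eq_bot, LinearMap.ker_eq_bot']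
    intro p hp0
    have h1 : (p : Rm n) = (ZZ n).det ^ rr n * Φ p := (hΦ p).symm
    have hQ : IsP1Poly (Φ p) := isP1Poly_of_isPPoly (hV p p.2) h1
    have hzero : Φ p = 0 := eq_zero_of_coeff_eq_zero hQ fun c hc1 hc4 => by
      have h2 := congr_fun hp0 ⟨c - 1, by omega⟩
      simp only [Ψ, LinearMap.comp_apply, coeff4, LinearMap.pi_apply, lcoeff_apply,
        Pi.zero_apply] at h2
      rwa [Nat.sub_add_cancel hc1] at h2
    apply Subtype.ext
    rw [h1, hzero, mul_zero]
    rfl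
  calc Module.finrank ℂ V ≤ Module.finrank ℂ (Fin 4 → ℂ) :=
        LinearMap.finrank_le_finrank_of_injective hΨ
    _ = 4 := Module.finrank_fin_fun ℂ

/-! ### §9 The power-sum side: semi-invariants of `x₀^d + ⋯ + x_d^d` -/

/-- `ζ` is a primitive `d`-th root of unity. [folklore] -/
private theorem zeta_isPrimitiveRoot : IsPrimitiveRoot (zeta n) (n + 2) :=
  Complex.isPrimitiveRoot_exp (n + 2) (by omega)

/-- **Column degrees are multiples of `d`** (the stabilizing roots of unity
`diag(1, …, ζ, …, 1)` of `x₀^d + ⋯ + x_d^d`). [folklore] -/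
private theorem colDeg_dvd (hP : IsSPoly χ P) {e : Fin (n + 2 + 1) × Fin (n + 2 + 1) →₀ ℕ}
    (he : e ∈ P.support) (j : Fin (n + 2 + 1)) :
    (n + 2) ∣ (Finsupp.weight (wRC (n + 2 + 1)) e).2 j := by
  have hid : aeval (fun v : Fin (n + 2 + 1) × Fin (n + 2 + 1) => C (rootVec n j v.2) * X v) P = P := by
    apply MvPolynomial.eq_of_eval_eq_on_gl
    intro g
    rw [eval_aeval_eq]
    have h := hP.root j g
    rw [coe_torusElt] at h
    convert h using 2
    congr 1
    funext v
    rw [map_mul, eval_C, eval_X, Matrix.mul_diagonal, mul_comm]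
  have hc := congrArg (coeff e) hid
  rw [coeff_aeval_scale] at hc
  have h1 : (e.prod fun v k => rootVec n j v.2 ^ k) = 1 :=
    mul_right_cancel₀ (mem_support_iff.mp he) (hc.trans (one_mul _).symm)
  have h2 : (e.prod fun v k => rootVec n j v.2 ^ k) = zeta n ^ (Finsupp.weight (wRC (n + 2 + 1)) e).2 j := by
    unfold rootVec
    exact prod_pow_ite_snd e j (zeta n)
  rw [h2] at h1
  exact (zeta_isPrimitiveRoot.pow_eq_one_iff_dvd _).mp h1

/-- The `ZMod d`-valued column weight of a monomial is its column degree modulo `d`. [folklore] -/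
private theorem weight_wColZ (j : Fin (n + 2 + 1)) (e : Fin (n + 2 + 1) × Fin (n + 2 + 1) →₀ ℕ) :
    Finsupp.weight (wColZ n j) e = (((Finsupp.weight (wRC (n + 2 + 1)) e).2 j : ℕ) : ZMod (n + 2)) := by
  rw [weight_wRC_snd, Finsupp.weight_apply, Finsupp.sum, Nat.cast_sum]
  refine Finset.sum_congr rfl fun v _ => ?_
  unfold wColZ
  split_ifs
  · rw [nsmul_eq_mul, mul_one]
  · rw [smul_zero, Nat.cast_zero]

/-- The semi-invariant of the power sum is homogeneous of degree `0` for every `ZMod d`-valued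
column weight. [folklore] -/
private theorem isWeightedHomogeneous_S_colZ (hP : IsSPoly χ P) (j : Fin (n + 2 + 1)) :
    IsWeightedHomogeneous (wColZ n j) P (0 : ZMod (n + 2)) := by
  intro e he
  rw [weight_wColZ, ZMod.natCast_eq_zero_iff]
  exact colDeg_dvd hP (mem_support_iff.mpr he) j

/-- The determinant has degree `1` for every `ZMod d`-valued column weight. [folklore] -/
private theorem isWeightedHomogeneous_det_colZ (j : Fin (n + 2 + 1)) :
    IsWeightedHomogeneous (wColZ n j) (ZZ n).det (1 : ZMod (n + 2)) := by
  rw [Matrix.det_apply]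
  refine IsWeightedHomogeneous.sum _ _ _ fun σ _ => ?_
  have hprod : IsWeightedHomogeneous (wColZ n j) (∏ i, (ZZ n) (σ i) i) (∑ i, wColZ n j (σ i, i)) :=
    IsWeightedHomogeneous.prod _ _ _ fun i _ => by
      show IsWeightedHomogeneous _ (X (σ i, i)) _
      exact isWeightedHomogeneous_X _ _ _
  have hsum : ∑ i, wColZ n j (σ i, i) = 1 := by
    simp only [wColZ]
    rw [Finset.sum_ite_eq' Finset.univ j, if_pos (Finset.mem_univ _)]
  rw [hsum] at hprod
  rw [Units.smul_def]
  exact zsmul_mem (show _ ∈ weightedHomogeneousSubmodule ℂ _ _ from hprod) _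

/-- The quotient `P₁` of a semi-invariant of the power sum has all column degrees `≡ 0 (mod d)`.
[folklore] -/
private theorem isWeightedHomogeneous_S1_colZ (hP : IsSPoly χ P) (h1 : P = (ZZ n).det ^ rr n * P₁)
    (j : Fin (n + 2 + 1)) : IsWeightedHomogeneous (wColZ n j) P₁ (0 : ZMod (n + 2)) := by
  have hdet0 : (ZZ n).det ^ rr n ≠ 0 :=
    pow_ne_zero _ (Matrix.det_mvPolynomialX_ne_zero (Fin (n + 2 + 1)) ℂ)
  have hhomD : IsWeightedHomogeneous (wColZ n j) ((ZZ n).det ^ rr n) (rr n • (1 : ZMod (n + 2))) :=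
    (isWeightedHomogeneous_det_colZ (n := n) j).pow _
  have hzero : rr n • (1 : ZMod (n + 2)) = 0 := by
    rw [nsmul_eq_mul, mul_one, rr_def, Nat.cast_mul, ZMod.natCast_self, mul_zero]
  rw [hzero] at hhomD
  exact isWeightedHomogeneous_of_mul hhomD hdet0 (h1 ▸ isWeightedHomogeneous_S_colZ hP j) (zero_add 0)

/-- The hypotheses on the quotient `P₁ = P / det^{10d}` on the power-sum side: row degrees `ρ'`, column
degrees `≡ 0 (mod d)`, invariance under all column permutations and under the raising substitution.
[cite: DuttaGesmundoIkenmeyerJindalLysikovJSC2025, Thm. 4.10] -/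
structure IsS1Poly (Q : Rm n) : Prop where
  row : IsWeightedHomogeneous (fun v : Fin (n + 2 + 1) × Fin (n + 2 + 1) => (wRC (n + 2 + 1) v).1) Q (rho1 n)
  colz : ∀ j : Fin (n + 2 + 1), IsWeightedHomogeneous (wColZ n j) Q (0 : ZMod (n + 2))
  perm : ∀ τ : Equiv.Perm (Fin (n + 2 + 1)),
    rename (fun v : Fin (n + 2 + 1) × Fin (n + 2 + 1) => (v.1, τ v.2)) Q = Q
  raise : aeval (theta n) Q = Q

/-- The quotient `P₁ = P / det^{10d}` of a semi-invariant of the power sum satisfies `IsS1Poly`.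
[cite: DuttaGesmundoIkenmeyerJindalLysikovJSC2025, Thm. 4.10] -/
private theorem isS1Poly_of_isSPoly (hP : IsSPoly χ P) (h1 : P = (ZZ n).det ^ rr n * P₁) : IsS1Poly P₁ :=
  ⟨isWeightedHomogeneous_P1_row hP.toL h1, isWeightedHomogeneous_S1_colZ hP h1,
    fun τ => rename_perm_P1 h1 τ (hP.perm τ⁻¹), aeval_theta_P1 hP.toL h1⟩

/-! ### §10 The classification on the power-sum side: five coefficients -/

/-- The coefficient `a(m, j)` of `z_{d-1,j} z_d^{d·m - e_j}` in `Q`. [folklore] -/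
def aS (n : ℕ) (Q : Rm n) (m : Fin (n + 2 + 1) →₀ ℕ) (j : Fin (n + 2 + 1)) : ℂ :=
  coeff (eps n j ((n + 2) • m - Finsupp.single j 1)) Q

/-- Column degrees of a two-row exponent. [folklore] -/
private theorem weight_snd_eps (j₀ : Fin (n + 2 + 1)) (f₀ : Fin (n + 2 + 1) →₀ ℕ) (j : Fin (n + 2 + 1)) :
    (Finsupp.weight (wRC (n + 2 + 1)) (eps n j₀ f₀)).2 j = (f₀ + Finsupp.single j₀ 1 : Fin (n + 2 + 1) →₀ ℕ) j := by
  rw [weight_snd_eq_sum, Fintype.sum_eq_add (iA n) (iB n) iA_ne_iB (fun i hi =>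
    eps_apply_of_ne _ _ hi.1 hi.2 _), eps_apply_iA, eps_apply_iB, Finsupp.add_apply,
    Finsupp.single_apply, add_comm]
  by_cases hj : j = j₀
  · rw [if_pos hj, if_pos hj.symm]
  · rw [if_neg hj, if_neg (Ne.symm hj)]

/-- The total column content of a two-row exponent of row degrees `ρ'` is `5d`. [folklore] -/
private theorem sum_cols_eps {j₀ : Fin (n + 2 + 1)} {f₀ : Fin (n + 2 + 1) →₀ ℕ}
    (hrow : Finsupp.weight (fun v : Fin (n + 2 + 1) × Fin (n + 2 + 1) => (wRC (n + 2 + 1) v).1)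
      (eps n j₀ f₀) = rho1 n) :
    ∑ j, (f₀ + Finsupp.single j₀ 1 : Fin (n + 2 + 1) →₀ ℕ) j = 5 * (n + 2) := by
  have h1 : ∑ j, (Finsupp.weight (wRC (n + 2 + 1)) (eps n j₀ f₀)).2 j =
      ∑ i, (Finsupp.weight (wRC (n + 2 + 1)) (eps n j₀ f₀)).1 i := by
    rw [sum_weight_wRC_snd, sum_weight_wRC_fst]
  simp_rw [weight_snd_eps] at h1
  rw [h1, ← weight_fst, hrow, sum_rho1]

/-- **Shape of the exponents on the power-sum side**: `z_{d-1,j₀} z_d^{d·m - e_{j₀}}` with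
`∑ m = 5` and `m_{j₀} ≥ 1`. [folklore] -/
private theorem exists_eq_eps_smul {Q : Rm n} (hQ : IsS1Poly Q) {e : Fin (n + 2 + 1) × Fin (n + 2 + 1) →₀ ℕ}
    (he : coeff e Q ≠ 0) :
    ∃ (j₀ : Fin (n + 2 + 1)) (m : Fin (n + 2 + 1) →₀ ℕ), m j₀ ≠ 0 ∧ ∑ j, m j = 5 ∧
      e = eps n j₀ ((n + 2) • m - Finsupp.single j₀ 1) := by
  obtain ⟨j₀, f₀, rfl⟩ := exists_eq_eps (hQ.row he)
  set F : Fin (n + 2 + 1) →₀ ℕ := f₀ + Finsupp.single j₀ 1 with hFdef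
  have hdvd : ∀ j, (n + 2) ∣ F j := fun j => by
    have h0 := hQ.colz j he
    rw [weight_wColZ, weight_snd_eps, ZMod.natCast_eq_zero_iff] at h0
    exact h0
  have hsum : ∑ j, F j = 5 * (n + 2) := sum_cols_eps (hQ.row he)
  have hF : (n + 2) • (Finsupp.equivFunOnFinite.symm fun j => F j / (n + 2)) = F := by
    ext j
    rw [Finsupp.smul_apply, Finsupp.coe_equivFunOnFinite_symm, smul_eq_mul, Nat.mul_div_cancel' (hdvd j)]
  refine ⟨j₀, Finsupp.equivFunOnFinite.symm fun j => F j / (n + 2), ?_, ?_, ?_⟩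
  · rw [Finsupp.coe_equivFunOnFinite_symm]
    intro h0
    have h1 := Nat.div_mul_cancel (hdvd j₀)
    rw [h0, zero_mul] at h1
    have h2 : F j₀ ≠ 0 := by simp [hFdef]
    exact h2 h1.symm
  · have h1 : ∑ j, F j / (n + 2) * (n + 2) = 5 * (n + 2) := by
      rw [← hsum]
      exact Finset.sum_congr rfl fun j _ => Nat.div_mul_cancel (hdvd j)
    rw [← Finset.sum_mul] at h1
    simp only [Finsupp.coe_equivFunOnFinite_symm]
    exact Nat.eq_of_mul_eq_mul_right (by omega : 0 < n + 2) h1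
  · rw [hF, hFdef, add_tsub_cancel_right]

/-- **Uniformity inside a fiber**: `a(m, j) = a(m, j')` if `m_j = m_{j'}` (swap the two columns).
[folklore] -/
private theorem aS_eq_of_apply_eq {Q : Rm n}
    (hperm : ∀ τ : Equiv.Perm (Fin (n + 2 + 1)),
      rename (fun v : Fin (n + 2 + 1) × Fin (n + 2 + 1) => (v.1, τ v.2)) Q = Q)
    (m : Fin (n + 2 + 1) →₀ ℕ) {j j' : Fin (n + 2 + 1)} (hjj : m j = m j') : aS n Q m j = aS n Q m j' := by
  by_cases he : j = j'
  · rw [he]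
  have hswap : ((n + 2) • m - Finsupp.single j 1).mapDomain (Equiv.swap j j') =
      (n + 2) • m - Finsupp.single j' 1 := by
    ext b
    rw [Finsupp.mapDomain_equiv_apply, Equiv.symm_swap, Finsupp.tsub_apply, Finsupp.tsub_apply,
      Finsupp.smul_apply, Finsupp.smul_apply, smul_eq_mul, smul_eq_mul, Finsupp.single_apply,
      Finsupp.single_apply]
    by_cases hb : b = j'
    · rw [hb, Equiv.swap_apply_right, if_pos rfl, if_pos rfl, hjj]
    · by_cases hb' : b = j
      · rw [hb', Equiv.swap_apply_left, if_neg he, if_neg (Ne.symm he), hjj]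
      · rw [Equiv.swap_apply_of_ne_of_ne hb' hb, if_neg (Ne.symm hb'), if_neg (Ne.symm hb)]
  have h1 := coeff_eps_perm (Equiv.swap j j') (hperm _) j ((n + 2) • m - Finsupp.single j 1)
  rw [Equiv.swap_apply_left, hswap] at h1
  exact h1.symm

/-- **The raising relation on the power-sum side**: `∑_{j : m_j ≠ 0} a(m, j) = 0`. [folklore] -/
private theorem sum_aS_eq_zero {Q : Rm n} (hQ : IsS1Poly Q) (m : Fin (n + 2 + 1) →₀ ℕ) :
    ∑ j ∈ Finset.univ.filter (fun j => m j ≠ 0), aS n Q m j = 0 := by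
  have h := sum_coeff_eps_eq_zero hQ.row hQ.raise ((n + 2) • m)
  have hf : Finset.univ.filter (fun j => ((n + 2) • m) j ≠ 0) = Finset.univ.filter (fun j => m j ≠ 0) :=
    Finset.filter_congr fun j _ => by
      rw [Finsupp.smul_apply, smul_eq_mul]
      exact ⟨fun h hm => h (by rw [hm, mul_zero]), fun h => Nat.mul_ne_zero (by omega) h⟩
  rw [hf] at h
  exact h

/-- **Killing one value class**: if all coefficients at the other nonzero values vanish, the
raising relation `#{m = c} · a = 0` kills the class of `c`. [folklore] -/
private theorem aS_eq_zero_of_others {Q : Rm n} (hQ : IsS1Poly Q) (m : Fin (n + 2 + 1) →₀ ℕ) {c : ℕ}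
    (hc : c ≠ 0) (hothers : ∀ j, m j ≠ 0 → m j ≠ c → aS n Q m j = 0) {j₁ : Fin (n + 2 + 1)}
    (hj₁ : m j₁ = c) : aS n Q m j₁ = 0 := by
  have hrel := sum_aS_eq_zero hQ m
  rw [← Finset.sum_filter_add_sum_filter_not (Finset.univ.filter fun j => m j ≠ 0) (fun j => m j = c)]
    at hrel
  have hA : (Finset.univ.filter (fun j => m j ≠ 0)).filter (fun j => m j = c) =
      Finset.univ.filter (fun j => m j = c) := by
    ext j
    simp only [Finset.mem_filter, Finset.mem_univ, true_and]
    exact ⟨fun h => h.2, fun h => ⟨by rw [h]; exact hc, h⟩⟩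
  have hB : ∑ j ∈ (Finset.univ.filter (fun j => m j ≠ 0)).filter (fun j => ¬ m j = c), aS n Q m j = 0 :=
    Finset.sum_eq_zero fun j hj => by
      simp only [Finset.mem_filter, Finset.mem_univ, true_and] at hj
      exact hothers j hj.1 hj.2
  rw [hB, add_zero, hA, Finset.sum_congr rfl (fun j hj => aS_eq_of_apply_eq hQ.perm m
      ((Finset.mem_filter.mp hj).2.trans hj₁.symm)), Finset.sum_const, nsmul_eq_mul] at hrel
  have hcard : ((Finset.univ.filter (fun j => m j = c)).card : ℂ) ≠ 0 := by
    have h0 : 0 < (Finset.univ.filter (fun j => m j = c)).card :=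
      Finset.card_pos.mpr ⟨j₁, Finset.mem_filter.mpr ⟨Finset.mem_univ _, hj₁⟩⟩
    exact_mod_cast h0.ne'
  exact (mul_eq_zero.mp hrel).resolve_left hcard

/-- **Transport along a column permutation**: `a(m ∘ σ⁻¹, σ j) = a(m, j)`. [folklore] -/
private theorem aS_mapDomain {Q : Rm n}
    (hperm : ∀ τ : Equiv.Perm (Fin (n + 2 + 1)),
      rename (fun v : Fin (n + 2 + 1) × Fin (n + 2 + 1) => (v.1, τ v.2)) Q = Q)
    (σ : Equiv.Perm (Fin (n + 2 + 1))) (m : Fin (n + 2 + 1) →₀ ℕ) (j : Fin (n + 2 + 1)) :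
    aS n Q (m.mapDomain σ) (σ j) = aS n Q m j := by
  unfold aS
  have hexp : (n + 2) • m.mapDomain σ - Finsupp.single (σ j) 1 =
      ((n + 2) • m - Finsupp.single j 1).mapDomain σ := by
    ext b
    rw [Finsupp.mapDomain_equiv_apply, Finsupp.tsub_apply, Finsupp.tsub_apply, Finsupp.smul_apply,
      Finsupp.smul_apply, Finsupp.mapDomain_equiv_apply, Finsupp.single_apply, Finsupp.single_apply]
    by_cases hb : σ j = b
    · rw [if_pos hb, if_pos ((Equiv.eq_symm_apply σ).mpr hb)]
    · rw [if_neg hb, if_neg (fun h' => hb ((Equiv.eq_symm_apply σ).mp h'))]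
  rw [hexp]
  exact coeff_eps_perm σ (hperm σ) j _

/-- **At most two nonzero values**: three distinct nonzero values would sum to at least `6 > 5`.
[folklore] -/
private theorem false_of_three_values {m : Fin (n + 2 + 1) →₀ ℕ} (hsum : ∑ j, m j = 5)
    {j₁ j₂ j₃ : Fin (n + 2 + 1)} (h1 : m j₁ ≠ 0) (h2 : m j₂ ≠ 0) (h3 : m j₃ ≠ 0)
    (h12 : m j₁ ≠ m j₂) (h13 : m j₁ ≠ m j₃) (h23 : m j₂ ≠ m j₃) : False := by
  have hne12 : j₁ ≠ j₂ := fun h => h12 (by rw [h])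
  have hne13 : j₁ ≠ j₃ := fun h => h13 (by rw [h])
  have hne23 : j₂ ≠ j₃ := fun h => h23 (by rw [h])
  have hle : ∑ j ∈ ({j₁, j₂, j₃} : Finset (Fin (n + 2 + 1))), m j ≤ ∑ j, m j :=
    Finset.sum_le_sum_of_subset (Finset.subset_univ _)
  rw [Finset.sum_insert (by simp [hne12, hne13]), Finset.sum_insert (by simp [hne23]),
    Finset.sum_singleton, hsum] at hle
  omega

/-- The total content of a two-valued `m`. [folklore] -/
private theorem sum_eq_of_two_values {m : Fin (n + 2 + 1) →₀ ℕ} {v w : ℕ} (hvw : v ≠ w)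
    (hval : ∀ j, m j = 0 ∨ m j = v ∨ m j = w) :
    ∑ j, m j = v * (Finset.univ.filter (fun j => m j = v)).card +
      w * (Finset.univ.filter (fun j => m j = w)).card := by
  have hpt : ∀ j, m j = (if m j = v then v else 0) + (if m j = w then w else 0) := by
    intro j
    rcases hval j with h | h | h
    · rw [h]
      by_cases hv : (0 : ℕ) = v
      · rw [if_pos hv, ← hv, zero_add]
        split_ifs with hw
        · exact hw
        · rfl
      · rw [if_neg hv, zero_add]
        split_ifs with hw
        · exact hw
        · rfl
    · rw [h, if_pos rfl, if_neg hvw, add_zero]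
    · rw [h, if_neg (Ne.symm hvw), if_pos rfl, zero_add]
  calc ∑ j, m j = ∑ j, ((if m j = v then v else 0) + (if m j = w then w else 0)) :=
        Finset.sum_congr rfl fun j _ => hpt j
    _ = ∑ j, (if m j = v then v else 0) + ∑ j, (if m j = w then w else 0) := Finset.sum_add_distrib
    _ = v * (Finset.univ.filter (fun j => m j = v)).card +
          w * (Finset.univ.filter (fun j => m j = w)).card := by
        rw [← Finset.sum_filter, ← Finset.sum_filter, Finset.sum_const, Finset.sum_const, smul_eq_mul,
          smul_eq_mul, mul_comm _ v, mul_comm _ w]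

/-- `#{j : j < k} = k` for `k ≤ N`. [folklore] -/
private theorem card_filter_lt {k : ℕ} (hk : k ≤ n + 2 + 1) :
    (Finset.univ.filter (fun j : Fin (n + 2 + 1) => (j : ℕ) < k)).card = k := by
  rw [Fin.card_filter_val_lt, min_eq_right hk]

/-- Values of the block representative. [folklore] -/
private theorem mRep_apply (v a w b : ℕ) (j : Fin (n + 2 + 1)) :
    mRep n v a w b j = if (j : ℕ) < a then v else if (j : ℕ) < a + b then w else 0 := by
  rw [mRep, Finsupp.coe_equivFunOnFinite_symm]

/-- The block representative takes the values `v`, `w`, `0` only. [folklore] -/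
private theorem mRep_values (v a w b : ℕ) (j : Fin (n + 2 + 1)) :
    mRep n v a w b j = v ∨ mRep n v a w b j = w ∨ mRep n v a w b j = 0 := by
  rw [mRep_apply]
  split_ifs
  · exact Or.inl rfl
  · exact Or.inr (Or.inl rfl)
  · exact Or.inr (Or.inr rfl)

/-- **Transport to the block representative**: a two-valued content vector is a column permutation
of `mRep v a w b` with `a = #{m = v}`, `b = #{m = w}` (fiberwise bijections, `Equiv.ofFiberEquiv`).
[folklore] -/
private theorem exists_perm_mRep {m : Fin (n + 2 + 1) →₀ ℕ} {v w : ℕ} (hv : v ≠ 0) (hw : w ≠ 0)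
    (hvw : v ≠ w) (hval : ∀ j, m j = 0 ∨ m j = v ∨ m j = w) :
    ∃ σ : Equiv.Perm (Fin (n + 2 + 1)), m.mapDomain σ =
      mRep n v (Finset.univ.filter (fun j => m j = v)).card w (Finset.univ.filter (fun j => m j = w)).card := by
  set a := (Finset.univ.filter (fun j => m j = v)).card with hadef
  set b := (Finset.univ.filter (fun j => m j = w)).card with hbdef
  -- the zero fiber of `m`
  have hsplit : (Finset.univ.filter (fun j => m j = v)).card + (Finset.univ.filter (fun j => m j = w)).card +
      (Finset.univ.filter (fun j => m j = 0)).card = n + 2 + 1 := by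
    have h1 := Finset.card_filter_add_card_filter_not (s := (Finset.univ : Finset (Fin (n + 2 + 1))))
      (fun j => m j = v ∨ m j = w)
    rw [Finset.filter_or, Finset.card_union_of_disjoint (Finset.disjoint_filter.mpr
      fun j _ h1 h2 => hvw (h1.symm.trans h2)), Finset.card_univ, Fintype.card_fin] at h1
    have h0 : Finset.univ.filter (fun j => m j = 0) =
        Finset.univ.filter (fun j => ¬(m j = v ∨ m j = w)) :=
      Finset.filter_congr fun j _ => by
        rcases hval j with h | h | h
        · rw [h]; exact ⟨fun _ => not_or.mpr ⟨fun h' => hv h'.symm, fun h' => hw h'.symm⟩, fun _ => rfl⟩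
        · rw [h]; exact ⟨fun h' => absurd h' hv, fun h' => absurd (Or.inl rfl) h'⟩
        · rw [h]; exact ⟨fun h' => absurd h' hw, fun h' => absurd (Or.inr rfl) h'⟩
    rw [h0]
    exact h1
  have hab : a + b ≤ n + 2 + 1 := by rw [hadef, hbdef]; omega
  -- fiber cardinalities of the representative
  have hRv : (Finset.univ.filter (fun j => mRep n v a w b j = v)).card = a := by
    have e : Finset.univ.filter (fun j => mRep n v a w b j = v) =
        Finset.univ.filter (fun j : Fin (n + 2 + 1) => (j : ℕ) < a) :=
      Finset.filter_congr fun j _ => by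
        rw [mRep_apply]
        split_ifs with h1 h2
        · exact ⟨fun _ => h1, fun _ => rfl⟩
        · exact ⟨fun h => absurd h hvw.symm, fun h => absurd h h1⟩
        · exact ⟨fun h => absurd h hv.symm, fun h => absurd h h1⟩
    rw [e, card_filter_lt (le_trans (Nat.le_add_right a b) hab)]
  have hRw : (Finset.univ.filter (fun j => mRep n v a w b j = w)).card = b := by
    have e : Finset.univ.filter (fun j => mRep n v a w b j = w) =
        Finset.univ.filter (fun j : Fin (n + 2 + 1) => (j : ℕ) < a + b ∧ ¬ (j : ℕ) < a) :=
      Finset.filter_congr fun j _ => by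
        rw [mRep_apply]
        split_ifs with h4 h5
        · exact ⟨fun h => absurd h hvw, fun h => absurd h4 h.2⟩
        · exact ⟨fun _ => ⟨h5, h4⟩, fun _ => rfl⟩
        · exact ⟨fun h => absurd h hw.symm, fun h => absurd h.1 h5⟩
    have h1 := Finset.card_filter_add_card_filter_not
      (s := Finset.univ.filter (fun j : Fin (n + 2 + 1) => (j : ℕ) < a + b)) (fun j => (j : ℕ) < a)
    rw [Finset.filter_filter, Finset.filter_filter, card_filter_lt hab] at h1
    have h2 : (Finset.univ.filter (fun j : Fin (n + 2 + 1) => (j : ℕ) < a + b ∧ (j : ℕ) < a)).card = a := by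
      have e2 : Finset.univ.filter (fun j : Fin (n + 2 + 1) => (j : ℕ) < a + b ∧ (j : ℕ) < a) =
          Finset.univ.filter (fun j : Fin (n + 2 + 1) => (j : ℕ) < a) :=
        Finset.filter_congr fun j _ => ⟨fun h => h.2, fun h => ⟨by omega, h⟩⟩
      rw [e2, card_filter_lt (le_trans (Nat.le_add_right a b) hab)]
    rw [h2] at h1
    rw [e]
    omega
  have hR0 : (Finset.univ.filter (fun j => mRep n v a w b j = 0)).card = n + 2 + 1 - (a + b) := by
    have e : Finset.univ.filter (fun j => mRep n v a w b j = 0) =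
        Finset.univ.filter (fun j : Fin (n + 2 + 1) => ¬ (j : ℕ) < a + b) :=
      Finset.filter_congr fun j _ => by
        rw [mRep_apply]
        split_ifs with h4 h5
        · exact ⟨fun h => absurd h hv, fun h => absurd (h4.trans_le (Nat.le_add_right a b)) h⟩
        · exact ⟨fun h => absurd h hw, fun h => absurd h5 h⟩
        · exact ⟨fun _ => h5, fun _ => rfl⟩
    have h1 := Finset.card_filter_add_card_filter_not (s := (Finset.univ : Finset (Fin (n + 2 + 1))))
      (fun j => (j : ℕ) < a + b)
    rw [card_filter_lt hab, Finset.card_univ, Fintype.card_fin] at h1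
    rw [e]
    omega
  have hRc : ∀ c, c ≠ v → c ≠ w → c ≠ 0 → (Finset.univ.filter (fun j => mRep n v a w b j = c)).card = 0 := by
    intro c hcv hcw hc0
    rw [Finset.card_eq_zero, Finset.filter_eq_empty_iff]
    intro j _ h
    rcases mRep_values (n := n) v a w b j with h' | h' | h'
    · exact hcv (h.symm.trans h')
    · exact hcw (h.symm.trans h')
    · exact hc0 (h.symm.trans h')
  have hMc : ∀ c, c ≠ v → c ≠ w → c ≠ 0 → (Finset.univ.filter (fun j => m j = c)).card = 0 := by
    intro c hcv hcw hc0
    rw [Finset.card_eq_zero, Finset.filter_eq_empty_iff]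
    intro j _ h
    rcases hval j with h' | h' | h'
    · exact hc0 (h.symm.trans h')
    · exact hcv (h.symm.trans h')
    · exact hcw (h.symm.trans h')
  have hM0 : (Finset.univ.filter (fun j => m j = 0)).card = n + 2 + 1 - (a + b) := by
    rw [hadef, hbdef]; omega
  -- fiberwise cardinalities agree
  have hcard : ∀ c : ℕ, Fintype.card {j // m j = c} = Fintype.card {j // mRep n v a w b j = c} := by
    intro c
    rw [Fintype.card_subtype, Fintype.card_subtype]
    by_cases hcv : c = v
    · rw [hcv, hRv]
    · by_cases hcw : c = w
      · rw [hcw, hRw]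
      · by_cases hc0 : c = 0
        · rw [hc0, hM0, hR0]
        · rw [hMc c hcv hcw hc0, hRc c hcv hcw hc0]
  let σ : Fin (n + 2 + 1) ≃ Fin (n + 2 + 1) :=
    Equiv.ofFiberEquiv (f := fun j => m j) (g := fun j => mRep n v a w b j)
      fun c => Fintype.equivOfCardEq (hcard c)
  refine ⟨σ, ?_⟩
  ext b'
  rw [Finsupp.mapDomain_equiv_apply]
  have h := Equiv.ofFiberEquiv_map (f := fun j => m j) (g := fun j => mRep n v a w b j)
    (fun c => Fintype.equivOfCardEq (hcard c)) (σ.symm b')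
  simp only [σ, Equiv.apply_symm_apply] at h
  exact h.symm

/-- **The two-valued case**: if the coefficient at the block representative vanishes, so does
every `a(m, j)` for `m` of the same type. [folklore] -/
private theorem aS_eq_zero_of_two_values {Q : Rm n} (hQ : IsS1Poly Q) {m : Fin (n + 2 + 1) →₀ ℕ}
    {v w : ℕ} (hv : v ≠ 0) (hw : w ≠ 0) (hvw : v ≠ w) (hval : ∀ j, m j = 0 ∨ m j = v ∨ m j = w)
    (ha : 0 < (Finset.univ.filter (fun j => m j = v)).card)
    (hrep : aS n Q (mRep n v (Finset.univ.filter (fun j => m j = v)).card w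
      (Finset.univ.filter (fun j => m j = w)).card) 0 = 0)
    {j₀ : Fin (n + 2 + 1)} (hj₀ : m j₀ ≠ 0) : aS n Q m j₀ = 0 := by
  obtain ⟨σ, hσ⟩ := exists_perm_mRep hv hw hvw hval
  set a := (Finset.univ.filter (fun j => m j = v)).card with hadef
  set b := (Finset.univ.filter (fun j => m j = w)).card with hbdef
  rw [← aS_mapDomain hQ.perm σ m j₀, hσ]
  have hval' : mRep n v a w b (σ j₀) = m j₀ := by
    have h := congrArg (fun f : Fin (n + 2 + 1) →₀ ℕ => f (σ j₀)) hσ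
    simp only [Finsupp.mapDomain_equiv_apply, Equiv.symm_apply_apply] at h
    exact h.symm
  have hrep0 : mRep n v a w b 0 = v := by
    rw [mRep_apply, if_pos (by rw [Fin.val_zero]; exact ha)]
  have hfirst : ∀ j, mRep n v a w b j = v → aS n Q (mRep n v a w b) j = 0 := fun j hj =>
    (aS_eq_of_apply_eq hQ.perm _ (hj.trans hrep0.symm)).trans hrep
  rcases hval j₀ with h0 | hvj | hwj
  · exact absurd h0 hj₀
  · exact hfirst _ (hval'.trans hvj)
  · refine aS_eq_zero_of_others hQ _ hw (fun j hj1 hj2 => hfirst j ?_) (hval'.trans hwj)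
    rcases mRep_values (n := n) v a w b j with h | h | h
    · exact h
    · exact absurd h hj2
    · exact absurd h hj1

/-- **Classification on the power-sum side**: a polynomial satisfying `IsS1Poly` all of whose
coefficients at the block representatives `mRep v a w b` (`v > w ≥ 1`, `va + wb = 5`, column `0`)
vanish is zero. Every monomial is `z_{d-1,j} z_d^{d·m - e_j}` with `∑ m = 5`; `m` has at most two
nonzero values (`1 + 2 + 3 > 5`); a one-valued class is killed by its raising relation, a two-valued
one is carried to its block representative by a column permutation.
[cite: DuttaGesmundoIkenmeyerJindalLysikovJSC2025, Thm. 4.10] -/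
private theorem eq_zero_of_forall_aS_mRep {Q : Rm n} (hQ : IsS1Poly Q)
    (h : ∀ v a w b : ℕ, v ≠ 0 → w ≠ 0 → w < v → 0 < a → 0 < b → v * a + w * b = 5 →
      aS n Q (mRep n v a w b) 0 = 0) : Q = 0 := by
  by_contra hQ0
  obtain ⟨e₀, he₀⟩ := ne_zero_iff.mp hQ0
  obtain ⟨j₀, m, hj₀, hsum, rfl⟩ := exists_eq_eps_smul hQ he₀
  apply he₀
  show aS n Q m j₀ = 0
  by_cases hone : ∀ j, m j ≠ 0 → m j = m j₀
  · exact aS_eq_zero_of_others hQ m hj₀ (fun j hj hne => absurd (hone j hj) hne) rfl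
  · push Not at hone
    obtain ⟨j₁, hj₁, hne⟩ := hone
    have hval : ∀ j, m j = 0 ∨ m j = m j₀ ∨ m j = m j₁ := by
      intro j
      by_contra hcon
      push Not at hcon
      exact false_of_three_values hsum hcon.1 hj₀ hj₁ hcon.2.1 hcon.2.2 hne.symm
    have hcount := sum_eq_of_two_values hne.symm hval
    rw [hsum] at hcount
    have ha : 0 < (Finset.univ.filter (fun j => m j = m j₀)).card :=
      Finset.card_pos.mpr ⟨j₀, Finset.mem_filter.mpr ⟨Finset.mem_univ _, rfl⟩⟩
    have hb : 0 < (Finset.univ.filter (fun j => m j = m j₁)).card :=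
      Finset.card_pos.mpr ⟨j₁, Finset.mem_filter.mpr ⟨Finset.mem_univ _, rfl⟩⟩
    rcases Nat.lt_or_gt_of_ne hne with hlt | hgt
    · exact aS_eq_zero_of_two_values hQ hj₀ hj₁ hne.symm hval ha
        (h _ _ _ _ hj₀ hj₁ hlt ha hb hcount.symm) hj₀
    · have hval' : ∀ j, m j = 0 ∨ m j = m j₁ ∨ m j = m j₀ := fun j =>
        (hval j).elim Or.inl fun h' => Or.inr h'.symm
      exact aS_eq_zero_of_two_values hQ hj₁ hj₀ hne hval' hb
        (h _ _ _ _ hj₁ hj₀ hgt hb ha (by rw [add_comm]; exact hcount.symm)) hj₀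

/-- The five block types `(v, a, w, b)` with `v > w ≥ 1`, `va + wb = 5`:
`(4,1,1,1), (3,1,2,1), (3,1,1,2), (2,2,1,1), (2,1,1,3)` = the partitions
`(4,1), (3,2), (3,1,1), (2,2,1), (2,1,1,1)` of `5` with two distinct parts. [folklore] -/
def repV : Fin 5 → ℕ := ![4, 3, 3, 2, 2]

/-- See `repV`. [folklore] -/
def repA : Fin 5 → ℕ := ![1, 1, 1, 2, 1]

/-- See `repV`. [folklore] -/
def repW : Fin 5 → ℕ := ![1, 2, 1, 1, 1]

/-- See `repV`. [folklore] -/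
def repB : Fin 5 → ℕ := ![1, 1, 2, 1, 3]

/-- The linear map extracting the five coefficients at the block representatives. [folklore] -/
def coeff5 (n : ℕ) : Rm n →ₗ[ℂ] (Fin 5 → ℂ) :=
  LinearMap.pi fun k : Fin 5 =>
    lcoeff ℂ (eps n 0 ((n + 2) • mRep n (repV k) (repA k) (repW k) (repB k) - Finsupp.single 0 1))

/-- The enumeration of the two-valued types: `va + wb = 5`, `v > w ≥ 1`, `a, b ≥ 1` has exactly the
five solutions of `repV/repA/repW/repB`. [folklore] -/
private theorem exists_rep_of_eq {v a w b : ℕ} (hv : v ≠ 0) (hw : w ≠ 0) (hwv : w < v) (ha : 0 < a)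
    (hb : 0 < b) (h : v * a + w * b = 5) :
    ∃ k : Fin 5, repV k = v ∧ repA k = a ∧ repW k = w ∧ repB k = b := by
  have hv5 : v ≤ 5 := (Nat.le_mul_of_pos_right v ha).trans (by omega)
  have hw5 : w ≤ 5 := (Nat.le_mul_of_pos_right w hb).trans (by omega)
  have key : (v = 4 ∧ a = 1 ∧ w = 1 ∧ b = 1) ∨ (v = 3 ∧ a = 1 ∧ w = 2 ∧ b = 1) ∨
      (v = 3 ∧ a = 1 ∧ w = 1 ∧ b = 2) ∨ (v = 2 ∧ a = 2 ∧ w = 1 ∧ b = 1) ∨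
      (v = 2 ∧ a = 1 ∧ w = 1 ∧ b = 3) := by
    interval_cases v <;> interval_cases w <;> omega
  rcases key with ⟨rfl, rfl, rfl, rfl⟩ | ⟨rfl, rfl, rfl, rfl⟩ | ⟨rfl, rfl, rfl, rfl⟩ |
      ⟨rfl, rfl, rfl, rfl⟩ | ⟨rfl, rfl, rfl, rfl⟩
  · exact ⟨0, rfl, rfl, rfl, rfl⟩
  · exact ⟨1, rfl, rfl, rfl, rfl⟩
  · exact ⟨2, rfl, rfl, rfl, rfl⟩
  · exact ⟨3, rfl, rfl, rfl, rfl⟩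
  · exact ⟨4, rfl, rfl, rfl, rfl⟩

/-- **At most five dimensions**: a subspace of `ℂ[Mat_{d+1}]` all of whose members satisfy
`IsSPoly` has dimension `≤ 5` (divide by `det^{10d}` and extract the five block coefficients).
[cite: DuttaGesmundoIkenmeyerJindalLysikovJSC2025, Thm. 4.10] -/
private theorem finrank_le_five_of_forall_isSPoly (V : Submodule ℂ (Rm n))
    (hV : ∀ P ∈ V, IsSPoly χ P) : Module.finrank ℂ V ≤ 5 := by
  set D : Rm n := (ZZ n).det ^ rr n with hDdef
  have hD : D ≠ 0 := pow_ne_zero _ (Matrix.det_mvPolynomialX_ne_zero (Fin (n + 2 + 1)) ℂ)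
  have hinj : Function.Injective (LinearMap.mulLeft ℂ D) := fun x y hxy => mul_left_cancel₀ hD hxy
  have hle : V ≤ LinearMap.range (LinearMap.mulLeft ℂ D) := by
    intro P hP
    obtain ⟨P₁, h1⟩ := exists_eq_det_pow_mul (hV P hP).toL
    exact ⟨P₁, h1.symm⟩
  let Φ : V →ₗ[ℂ] Rm n :=
    (LinearEquiv.ofInjective _ hinj).symm.toLinearMap ∘ₗ Submodule.inclusion hle
  have hΦ : ∀ p : V, D * Φ p = (p : Rm n) := fun p => by
    show LinearMap.mulLeft ℂ D ((LinearEquiv.ofInjective _ hinj).symm (Submodule.inclusion hle p)) = _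
    rw [LinearEquiv.ofInjective_symm_apply]
    rfl
  let Ψ : V →ₗ[ℂ] (Fin 5 → ℂ) := coeff5 n ∘ₗ Φ
  have hΨ : Function.Injective Ψ := by
    rw [← LinearMap.ker_eq_bot, LinearMap.ker_eq_bot']
    intro p hp0
    have h1 : (p : Rm n) = (ZZ n).det ^ rr n * Φ p := (hΦ p).symm
    have hQ : IsS1Poly (Φ p) := isS1Poly_of_isSPoly (hV p p.2) h1
    have hzero : Φ p = 0 := eq_zero_of_forall_aS_mRep hQ fun v a w b hv hw hwv ha hb h => by
      obtain ⟨k, rfl, rfl, rfl, rfl⟩ := exists_rep_of_eq hv hw hwv ha hb h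
      exact congr_fun hp0 k
    apply Subtype.ext
    rw [h1, hzero, mul_zero]
    rfl
  calc Module.finrank ℂ V ≤ Module.finrank ℂ (Fin 5 → ℂ) :=
        LinearMap.finrank_le_finrank_of_injective hΨ
    _ = 5 := Module.finrank_fin_fun ℂ

end Structure

/-! ### §7 The semi-invariants of `x₁⋯x_d + x₀^d` and the bound `mult ≤ 4` -/

section Assembly

open Literature.NumberTheory.DiophantineGeometry

variable {n : ℕ}

/-- Stabilizer, torus part: `diag(t₀, t₁, …, t_d)` with `t₀^d = 1` and `t₁ ⋯ t_d = 1` fixes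
`P^{[d]}_{1,1} = x₁⋯x_d + x₀^d`. [cite: DuttaGesmundoIkenmeyerJindalLysikovJSC2025, Prop. 4.11] -/
private theorem linSubst_diagonal_productPlusPower (d : ℕ) (t : Fin (d + 1) → ℂ) (h0 : t 0 ^ d = 1)
    (hprod : ∏ i : Fin d, t i.succ = 1) :
    linSubst (Fin (d + 1)) ℂ (Matrix.diagonal t) (productPlusPower ℂ d) = productPlusPower ℂ d := by
  have hX : ∀ i : Fin (d + 1), linSubst (Fin (d + 1)) ℂ (Matrix.diagonal t) (X i) = C (t i) * X i := by
    intro i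
    rw [linSubst_X, Finset.sum_eq_single i]
    · rw [Matrix.diagonal_apply_eq, smul_eq_C_mul]
    · intro j _ hj; rw [Matrix.diagonal_apply_ne _ hj, zero_smul]
    · intro h; exact absurd (Finset.mem_univ _) h
  unfold productPlusPower
  rw [map_add, map_prod, map_pow]
  simp_rw [hX]
  rw [Finset.prod_mul_distrib, ← map_prod, hprod, C_1, one_mul, mul_pow, ← map_pow, h0, C_1, one_mul]

/-- Stabilizer, permutation part: a permutation of the variables fixing `x₀` fixes
`P^{[d]}_{1,1}`. [cite: DuttaGesmundoIkenmeyerJindalLysikovJSC2025, Prop. 4.11] -/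
private theorem linSubst_permMatrix_productPlusPower (d : ℕ) (τ : Equiv.Perm (Fin (d + 1)))
    (h0 : τ 0 = 0) :
    linSubst (Fin (d + 1)) ℂ (τ.permMatrix ℂ) (productPlusPower ℂ d) = productPlusPower ℂ d := by
  rw [linSubst_permMatrix]
  unfold productPlusPower
  rw [map_add, map_prod, map_pow, rename_X]
  have h0' : τ.symm 0 = 0 := by rw [Equiv.symm_apply_eq]; exact h0.symm
  rw [h0']
  congr 1
  simp_rw [rename_X]
  have hne : ∀ i : Fin d, τ.symm i.succ ≠ 0 := by
    intro i h
    have := congrArg τ h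
    rw [Equiv.apply_symm_apply, h0] at this
    exact Fin.succ_ne_zero _ this
  let ρ : Fin d → Fin d := fun i => (τ.symm i.succ).pred (hne i)
  have hρ : Function.Bijective ρ := by
    refine (Finite.injective_iff_bijective).mp ?_
    intro i j hij
    have h := congrArg Fin.succ hij
    simp only [ρ, Fin.succ_pred] at h
    exact Fin.succ_injective _ (τ.symm.injective h)
  calc ∏ i : Fin d, (X (τ.symm i.succ) : MvPolynomial (Fin (d + 1)) ℂ)
      = ∏ i : Fin d, X (ρ i).succ := by simp only [ρ, Fin.succ_pred]
    _ = ∏ i : Fin d, X i.succ :=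
        Function.Bijective.prod_comp hρ (fun i : Fin d => (X i.succ : MvPolynomial (Fin (d + 1)) ℂ))

/-- **DGIJL Prop. 4.11 (general weight form)**: for `N = n + 2 + 1 = d + 1` and a weight `χ` with
`χ = -(10d, …, 10d, 10d+1, 15d-1)`, i.e. `χ = λ^*` for `λ = (15d-1, 10d+1, 10d, …, 10d)`, the
multiplicity of `χ` in `ℂ[\overline{GL_{d+1} · (x₁⋯x_d + x₀^d)}]_{10d+15}` is at most `4`: the
injection `HW_χ ↪ ℂ[Mat_{d+1}]` (`hwToPoly`) lands in the semi-invariants bounded by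
`finrank_le_four_of_forall_isPPoly`. [cite: DuttaGesmundoIkenmeyerJindalLysikovJSC2025, Prop. 4.11] -/
theorem orbitMultiplicity_productPlusPower_le_four' (n : ℕ) (χ : Weight (Fin (n + 2 + 1)))
    (hχ : ∀ i, χ i = -(rho n i : ℤ)) :
    orbitMultiplicity ℂ (productPlusPower ℂ (n + 2)) (n + 2) χ ≤ 4 := by
  have key : ∀ x : highestWeightSpace (orbitCoordRep (productPlusPower ℂ (n + 2)) (n + 2)) χ,
      IsPPoly χ (hwToPoly (productPlusPower ℂ (n + 2)) (n + 2) χ x) := by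
    intro x
    obtain ⟨F, hF⟩ := Ideal.Quotient.mk_surjective
      (x : OrbitCoordRing (productPlusPower ℂ (n + 2)) (n + 2))
    have hx : Ideal.Quotient.mk (orbitVanishingIdeal (productPlusPower ℂ (n + 2)) (n + 2)) F ∈
        highestWeightSpace (orbitCoordRep (productPlusPower ℂ (n + 2)) (n + 2)) χ := by
      rw [hF]; exact x.2
    have hΓx : hwToPoly (productPlusPower ℂ (n + 2)) (n + 2) χ x =
        orbitCoordToPoly (productPlusPower ℂ (n + 2)) (n + 2)
          (Ideal.Quotient.mk (orbitVanishingIdeal (productPlusPower ℂ (n + 2)) (n + 2)) F) := by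
      rw [hwToPoly_apply, ← hF]
    rw [hΓx]
    refine ⟨fun b hb g => eval_orbitCoordToPoly_mul_left _ _ hx hb g, fun a b ha hb hab g => ?_,
      fun τ hτ g => ?_, hχ⟩
    · refine eval_orbitCoordToPoly_mul_right _ _ F ?_ g
      rw [linSubstRep_apply, coe_torusElt]
      refine linSubst_diagonal_productPlusPower (n + 2) _ ?_ ?_
      · unfold tAB; rw [if_neg ha.symm, if_neg hb.symm, one_pow]
      · have h := prod_tAB (n := n) hab
        rw [Fin.prod_univ_succ] at h
        unfold tAB at h ⊢
        rwa [if_neg ha.symm, if_neg hb.symm, one_mul] at h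
    · have h := eval_orbitCoordToPoly_mul_right (productPlusPower ℂ (n + 2)) (n + 2) F
        (h := permGL τ) ?_ g
      · rwa [coe_permGL] at h
      · rw [linSubstRep_apply, coe_permGL]
        exact linSubst_permMatrix_productPlusPower (n + 2) τ hτ
  have hrange : ∀ P ∈ LinearMap.range (hwToPoly (productPlusPower ℂ (n + 2)) (n + 2) χ), IsPPoly χ P := by
    rintro _ ⟨x, rfl⟩; exact key x
  calc orbitMultiplicity ℂ (productPlusPower ℂ (n + 2)) (n + 2) χ
      = Module.finrank ℂ (highestWeightSpace (orbitCoordRep (productPlusPower ℂ (n + 2)) (n + 2)) χ) := rfl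
    _ = Module.finrank ℂ (LinearMap.range (hwToPoly (productPlusPower ℂ (n + 2)) (n + 2) χ)) :=
        (LinearMap.finrank_range_of_inj (hwToPoly_injective _ _ χ)).symm
    _ ≤ 4 := finrank_le_four_of_forall_isPPoly _ hrange

/-! ### §7b The semi-invariants of `x₀^d + ⋯ + x_d^d` and the bound `mult ≤ 5` -/

/-- Powers of the stabilizing roots of unity. [folklore] -/
private theorem rootVec_pow (j i : Fin (n + 2 + 1)) : rootVec n j i ^ (n + 2) = 1 := by
  unfold rootVec
  split_ifs
  · exact (zeta_isPrimitiveRoot (n := n)).pow_eq_one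
  · exact one_pow _

/-- Stabilizer of the power sum, torus part: `diag(t)` with `t_i^d = 1` fixes `x₀^d + ⋯ + x_d^d`.
[cite: DuttaGesmundoIkenmeyerJindalLysikovJSC2025, Thm. 4.10] -/
private theorem linSubst_diagonal_psum (t : Fin (n + 2 + 1) → ℂ) (ht : ∀ i, t i ^ (n + 2) = 1) :
    linSubst (Fin (n + 2 + 1)) ℂ (Matrix.diagonal t) (psum (Fin (n + 2 + 1)) ℂ (n + 2)) =
      psum (Fin (n + 2 + 1)) ℂ (n + 2) := by
  have hX : ∀ i : Fin (n + 2 + 1), linSubst (Fin (n + 2 + 1)) ℂ (Matrix.diagonal t) (X i) = C (t i) * X i := by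
    intro i
    rw [linSubst_X, Finset.sum_eq_single i]
    · rw [Matrix.diagonal_apply_eq, smul_eq_C_mul]
    · intro j _ hj; rw [Matrix.diagonal_apply_ne _ hj, zero_smul]
    · intro h; exact absurd (Finset.mem_univ _) h
  rw [psum, map_sum]
  refine Finset.sum_congr rfl fun i _ => ?_
  rw [map_pow, hX, mul_pow, ← map_pow, ht, C_1, one_mul]

/-- Stabilizer of the power sum, permutation part: every permutation of the variables fixes
`x₀^d + ⋯ + x_d^d`. [cite: DuttaGesmundoIkenmeyerJindalLysikovJSC2025, Thm. 4.10] -/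
private theorem linSubst_permMatrix_psum (τ : Equiv.Perm (Fin (n + 2 + 1))) :
    linSubst (Fin (n + 2 + 1)) ℂ (τ.permMatrix ℂ) (psum (Fin (n + 2 + 1)) ℂ (n + 2)) =
      psum (Fin (n + 2 + 1)) ℂ (n + 2) := by
  rw [linSubst_permMatrix, psum, map_sum]
  simp_rw [map_pow, rename_X]
  exact Equiv.sum_comp τ.symm (fun i => (X i : MvPolynomial (Fin (n + 2 + 1)) ℂ) ^ (n + 2))

/-- **The `≤ 5` half of Thm. 4.10's `= 5` (general weight form)**: for `N = n + 2 + 1 = d + 1` and a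
weight `χ = -(10d, …, 10d, 10d+1, 15d-1) = λ^*`, the multiplicity of `χ` in
`ℂ[\overline{GL_{d+1} · (x₀^d + ⋯ + x_d^d)}]_{10d+15}` is at most `5`: the injection `HW_χ ↪ ℂ[Mat_{d+1}]`
(`hwToPoly`) lands in the semi-invariants bounded by `finrank_le_five_of_forall_isSPoly` — the
five survivors are the two-valued partitions `(4,1), (3,2), (3,1,1), (2,2,1), (2,1,1,1)` of `5`, the
tree's rendering of IK'20 Prop. 4.1's count `mult_ν ℂ[GL_{d+1} p] = 5` used in DGIJL's proof of
Prop. 4.12 ("κ has exactly two nonzero entries in 5 cases"); with the localisation inequality this is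
the upper half of "`5 = mult_λ`" in Thm. 4.10. [cite: DuttaGesmundoIkenmeyerJindalLysikovJSC2025, Thm. 4.10] -/
theorem orbitMultiplicity_psum_le_five' (n : ℕ) (χ : Weight (Fin (n + 2 + 1)))
    (hχ : ∀ i, χ i = -(rho n i : ℤ)) :
    orbitMultiplicity ℂ (psum (Fin (n + 2 + 1)) ℂ (n + 2)) (n + 2) χ ≤ 5 := by
  have key : ∀ x : highestWeightSpace (orbitCoordRep (psum (Fin (n + 2 + 1)) ℂ (n + 2)) (n + 2)) χ,
      IsSPoly χ (hwToPoly (psum (Fin (n + 2 + 1)) ℂ (n + 2)) (n + 2) χ x) := by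
    intro x
    obtain ⟨F, hF⟩ := Ideal.Quotient.mk_surjective
      (x : OrbitCoordRing (psum (Fin (n + 2 + 1)) ℂ (n + 2)) (n + 2))
    have hx : Ideal.Quotient.mk (orbitVanishingIdeal (psum (Fin (n + 2 + 1)) ℂ (n + 2)) (n + 2)) F ∈
        highestWeightSpace (orbitCoordRep (psum (Fin (n + 2 + 1)) ℂ (n + 2)) (n + 2)) χ := by
      rw [hF]; exact x.2
    have hΓx : hwToPoly (psum (Fin (n + 2 + 1)) ℂ (n + 2)) (n + 2) χ x =
        orbitCoordToPoly (psum (Fin (n + 2 + 1)) ℂ (n + 2)) (n + 2)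
          (Ideal.Quotient.mk (orbitVanishingIdeal (psum (Fin (n + 2 + 1)) ℂ (n + 2)) (n + 2)) F) := by
      rw [hwToPoly_apply, ← hF]
    rw [hΓx]
    refine ⟨fun b hb g => eval_orbitCoordToPoly_mul_left _ _ hx hb g, fun j g => ?_, fun τ g => ?_, hχ⟩
    · refine eval_orbitCoordToPoly_mul_right _ _ F ?_ g
      rw [linSubstRep_apply, coe_torusElt]
      exact linSubst_diagonal_psum _ (rootVec_pow (n := n) j)
    · have h := eval_orbitCoordToPoly_mul_right (psum (Fin (n + 2 + 1)) ℂ (n + 2)) (n + 2) F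
        (h := permGL τ) ?_ g
      · rwa [coe_permGL] at h
      · rw [linSubstRep_apply, coe_permGL]
        exact linSubst_permMatrix_psum τ
  have hrange : ∀ P ∈ LinearMap.range (hwToPoly (psum (Fin (n + 2 + 1)) ℂ (n + 2)) (n + 2) χ),
      IsSPoly χ P := by
    rintro _ ⟨x, rfl⟩; exact key x
  calc orbitMultiplicity ℂ (psum (Fin (n + 2 + 1)) ℂ (n + 2)) (n + 2) χ
      = Module.finrank ℂ (highestWeightSpace (orbitCoordRep (psum (Fin (n + 2 + 1)) ℂ (n + 2)) (n + 2)) χ) :=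
        rfl
    _ = Module.finrank ℂ (LinearMap.range (hwToPoly (psum (Fin (n + 2 + 1)) ℂ (n + 2)) (n + 2) χ)) :=
        (LinearMap.finrank_range_of_inj (hwToPoly_injective _ _ χ)).symm
    _ ≤ 5 := finrank_le_five_of_forall_isSPoly _ hrange

/-! ### §8 The weight `λ^*` of `λ = (15d-1, 10d+1, 10d, …, 10d)` and DGIJL Prop. 4.11 -/

/-- The sorted parts of `λ = (15d-1, 10d+1, 10d, …, 10d)` (`d + 1` parts).
[cite: DuttaGesmundoIkenmeyerJindalLysikovJSC2025, Thm. 4.10] -/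
private theorem sortedParts_dgijlPartition {d : ℕ} (hd : 0 < d) :
    (dgijlPartition d hd).sortedParts = (15 * d - 1) :: (10 * d + 1) :: List.replicate (d - 1) (10 * d) := by
  change (dgijlPartition d hd).parts.sort (· ≥ ·) = _
  have hparts : (dgijlPartition d hd).parts =
      ↑((15 * d - 1) :: (10 * d + 1) :: List.replicate (d - 1) (10 * d)) := by
    rw [dgijlPartition, Nat.Partition.ofSums_parts, Multiset.filter_eq_self.mpr, Multiset.insert_eq_cons,
      Multiset.cons_add, Multiset.singleton_add, ← Multiset.coe_replicate, Multiset.cons_coe,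
      Multiset.cons_coe]
    intro a ha
    simp only [Multiset.insert_eq_cons, Multiset.mem_add, Multiset.mem_cons, Multiset.mem_singleton,
      Multiset.mem_replicate] at ha
    omega
  rw [hparts, Multiset.coe_sort]
  apply List.mergeSort_eq_self
  rw [List.pairwise_cons, List.pairwise_cons]
  refine ⟨fun b hb => ?_, fun b hb => ?_, List.pairwise_replicate.mpr (Or.inr le_rfl)⟩
  · rw [List.mem_cons, List.mem_replicate] at hb
    omega
  · rw [List.mem_replicate] at hb
    omega

/-- **The weight bookkeeping**: `λ^* = -(10d, …, 10d, 10d+1, 15d-1) = -ρ` for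
`λ = (15d-1, 10d+1, 10d, …, 10d)`, `d = n + 2`. [folklore] -/
private theorem dualOfPartition_dgijlPartition (n : ℕ) (h : 0 < n + 2) (i : Fin (n + 2 + 1)) :
    Weight.dualOfPartition (n + 2 + 1) (dgijlPartition (n + 2) h) i = -(rho n i : ℤ) := by
  simp only [Weight.dualOfPartition, Weight.dual, Weight.ofPartition_apply,
    sortedParts_dgijlPartition h]
  rw [neg_inj, Nat.cast_inj]
  unfold rho
  by_cases h2 : (i : ℕ) = n + 2
  · have hrev : ((Fin.rev i : Fin (n + 2 + 1)) : ℕ) = 0 := by rw [Fin.val_rev]; omega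
    rw [if_pos h2, hrev, List.getD_cons_zero]
  · by_cases h1 : (i : ℕ) = n + 1
    · have hrev : ((Fin.rev i : Fin (n + 2 + 1)) : ℕ) = 0 + 1 := by rw [Fin.val_rev]; omega
      rw [if_neg h2, if_pos h1, hrev, List.getD_cons_succ, List.getD_cons_zero]
    · obtain ⟨m, hm, hrev⟩ : ∃ m, m < n + 2 - 1 ∧ ((Fin.rev i : Fin (n + 2 + 1)) : ℕ) = m + 1 + 1 :=
        ⟨n - (i : ℕ), by have := i.isLt; omega, by rw [Fin.val_rev]; have := i.isLt; omega⟩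
      rw [if_neg h2, if_neg h1, hrev, List.getD_cons_succ, List.getD_cons_succ,
        List.getD_eq_getElem _ _ (by rw [List.length_replicate]; exact hm), List.getElem_replicate]

end Assembly

end DGIJL2025

open _root_.Literature.NumberTheory.DiophantineGeometry in
/-- **Dutta–Gesmundo–Ikenmeyer–Jindal–Lysikov 2025, Prop. 4.11** (the upper bound of Thm. 4.10;
arXiv:2211.07055): for `d ≥ 3` and `λ = (5d-1,1) + ((d+1) × (10d)) = (15d-1, 10d+1, 10d, …, 10d)`,
"`mult_λ(ℂ[\overline{GL_{d+1} P^{[d]}_{1,1}}]) ≤ mult_λ(ℂ[GL_{d+1} P^{[d]}_{1,1}]) = mult_ν(ℂ[GL_{d+1} P^{[d]}_{1,1}]) = 4`",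
`P^{[d]}_{1,1} = x₁⋯x_d + x₀^d`; here the inequality `mult_λ(ℂ[\overline{GL_{d+1} P^{[d]}_{1,1}}]) ≤ 4`
in the tree's rendering (`orbitMultiplicity` at the dual weight, as in `DGIJL2025_thm_4_10`), for every
`d ≥ 3` (the parity hypothesis of Thm. 4.10 is not used by the upper bound). Proved by the
classification of the Borel semi-invariants of weight `λ^*` on `Mat_{d+1}` that are invariant under
the stabilizing torus and the permutations of `x₁, …, x_d` (four of them, `det^{10d} · B_c`, `c = 1, …, 4`,
matching the paper's four summands `a_{(cd)}(d,c) = 1`), not by the printed plethysm count.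
This is the first conjunct of the named fact `DGIJL2025_thm_4_10` (whose discharge also needs
Prop. 4.12). [cite: DuttaGesmundoIkenmeyerJindalLysikovJSC2025, Prop. 4.11] -/
theorem orbitMultiplicity_productPlusPower_le_four (d : ℕ) (hd : 3 ≤ d) :
    orbitMultiplicity ℂ (productPlusPower ℂ d) d
        (Weight.dualOfPartition (d + 1) (dgijlPartition d (zero_lt_three.trans_le hd))) ≤ 4 := by
  obtain ⟨n, rfl⟩ : ∃ n, d = n + 2 := ⟨d - 2, by omega⟩
  exact DGIJL2025.orbitMultiplicity_productPlusPower_le_four' n _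
    fun i => DGIJL2025.dualOfPartition_dgijlPartition n _ i

open _root_.Literature.NumberTheory.DiophantineGeometry in
/-- **Dutta–Gesmundo–Ikenmeyer–Jindal–Lysikov 2025, Thm. 4.10 — the upper half of "`5 = mult_λ`"**
(arXiv:2211.07055): for `d ≥ 3` and `λ = (5d-1,1) + ((d+1) × (10d)) = (15d-1, 10d+1, 10d, …, 10d)`,
`mult_λ(ℂ[\overline{GL_{d+1}(x₀^d + ⋯ + x_d^d)}]) ≤ 5`, in the tree's rendering (`orbitMultiplicity` at the
dual weight, as in `DGIJL2025_thm_4_10`). Thm. 4.10 prints "`… < 5 = mult_λ(ℂ[\overline{GL_{d+1}(x_1^d+⋯+x_{d+1}^d)}])`";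
the printed argument for this half is the localisation inequality `mult_λ(cl) ≤ mult_λ(orbit)` [BI17] with
the orbit count `mult_ν ℂ[GL_{d+1} p] = Σ_{κ ⊢ 5} b(ν,κ,d,5) = 5` of IK'20 Prop. 4.1 in the proof of
Prop. 4.12; here the count is done on the semi-invariants (`IsSPoly`: Borel semi-invariance, invariance
under the `d`-th roots of unity on each coordinate and under `S_{d+1}`): every one is `det^{10d}` times a
two-row polynomial whose monomial contents `d·m`, `∑ m = 5`, fall into `S_{d+1}`-types with at most two
nonzero values, one free coefficient per two-valued type — the five partitions
`(4,1), (3,2), (3,1,1), (2,2,1), (2,1,1,1)` ("exactly two nonzero entries in 5 cases"). The parity of `d`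
is not used. Together with `orbitMultiplicity_productPlusPower_le_four` this leaves only the lower bound
Prop. 4.12 (`≥ 5`, IK'20 Main Technical Thm. 4.2) of the named fact `DGIJL2025_thm_4_10` open.
[cite: DuttaGesmundoIkenmeyerJindalLysikovJSC2025, Thm. 4.10] -/
theorem orbitMultiplicity_psum_dgijl_le_five (d : ℕ) (hd : 3 ≤ d) :
    orbitMultiplicity ℂ (MvPolynomial.psum (Fin (d + 1)) ℂ d) d
        (Weight.dualOfPartition (d + 1) (dgijlPartition d (zero_lt_three.trans_le hd))) ≤ 5 := by
  obtain ⟨n, rfl⟩ : ∃ n, d = n + 2 := ⟨d - 2, by omega⟩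
  exact DGIJL2025.orbitMultiplicity_psum_le_five' n _
    fun i => DGIJL2025.dualOfPartition_dgijlPartition n _ i

open _root_.Literature.NumberTheory.DiophantineGeometry in
/-- **Reduction of the named fact to Prop. 4.12.** With both upper bounds in the tree
(`orbitMultiplicity_productPlusPower_le_four` = Prop. 4.11 and `orbitMultiplicity_psum_dgijl_le_five` =
the upper half of "`= 5`"), DGIJL 2025 Thm. 4.10 as typed (`DGIJL2025_thm_4_10`: "`≤ 4`" and "`= 5`" for
even `d ≥ 3`) follows from its remaining printed ingredient, the lower bound of Prop. 4.12:
"`mult_λ(ℂ[\overline{GL_{d+1}(x_1^d+⋯+x_{d+1}^d)}]) ≥ 5`" (tableau lifting, [IK'20, Main Technical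
Thm. 4.2] with `e_Ξ = 10`), taken here as the hypothesis `h412` in the tree's rendering. This is a
reduction, not a discharge: `DGIJL2025_thm_4_10` stays a named fact until Prop. 4.12 is proved.
[cite: DuttaGesmundoIkenmeyerJindalLysikovJSC2025, Thm. 4.10] -/
theorem DGIJL2025_thm_4_10_of_five_le
    (h412 : ∀ (d : ℕ) (hd : 3 ≤ d), Even d →
      5 ≤ orbitMultiplicity ℂ (MvPolynomial.psum (Fin (d + 1)) ℂ d) d
        (Weight.dualOfPartition (d + 1) (dgijlPartition d (zero_lt_three.trans_le hd)))) :
    DGIJL2025_thm_4_10 :=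
  fun d hd he => ⟨orbitMultiplicity_productPlusPower_le_four d hd,
    le_antisymm (orbitMultiplicity_psum_dgijl_le_five d hd) (h412 d hd he)⟩


end Literature.Computability.AlgebraicComplexity
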